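import Literature.Computability.Cryptography.WordRAMStructuredBlocks
import Literature.Computability.FineGrained.NegativeTriangleToAPSP
import HarnessLib

/-!
# Negative Triangle `≤₃` Radius (Abboud–Grandoni–Vassilevska Williams 2015, Lemma 2.3): the word-RAM program

Abboud, Grandoni and Vassilevska Williams, *Subcubic equivalences between graph centrality problems,
APSP and diameter*, SODA 2015, prove that Radius is subcubically equivalent to APSP (Thm. 1.1); the
nontrivial direction is Lemma 2.3, a reduction from Negative Triangle: on the four-layer gadget graph
(layers `I, J, K, L`, arcs of weight `Q + w(u, v)` between consecutive layers, a node `y` at distance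
`3Q - 1` from every `I`-vertex) "we compute the radius `R*` … and output YES … if and only if
`R* ≤ 3Q - 1`". The prelude renders `≤₃` as `FGReducible` (VVW ICM 2018, Def. 2.1): the existence of
a concrete deterministic word-RAM oracle program. This file writes that program down as structured
code (`SProg` of `Literature.Computability.Cryptography.WordRAMStructured`) for the *dense* rendering
of the gadget (`Literature.Computability.Cryptography.RadiusGadgetGraph`: direct arcs of weight `2Q`
replace the sparse bit gadget of print) and proves the semantics of its phases; the assembly into
`FGReducible (NegativeTriangle c) (n ↦ n³) (Radius (c + 2)) (n ↦ n³)` is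
`Literature.Computability.FineGrained.NegativeTriangleToRadius`.

## The program `prog c`

On the input `⌜W⌝` (`n`, then the `n²` codes of the integer weights, `NegTriToAPSP.inp`):

* `relocate` (the library bootstrap): `n` lands at `n² + 101` and `n² + 102`, the code of entry
  `t = u n + v` at `pC n + t` (`pC n = n² + 103`);
* `setup1`, `powOps c` (`c` multiplications computing `M = nᶜ`), `setup2`: the layout registers
  (`Regs`): `N = 4 n + 1` (the gadget has `N` vertices), `Q = 2 nᶜ + 2`, the codes `2Q + 1` (base
  of the recoding), `4Q + 1 = ⌜2Q⌝`, `6Q - 1 = ⌜3Q - 1⌝`, the addresses of the query block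
  (`pQ n = 2 n² + 103`, header `N`, then the `N²` codes row-major) and of the answer (`pR n`), the
  in-row offsets of the arcs, and the header `mem[pQ n] := N`;
* **loop A** (`n²` iterations, `bodyA`): iteration `t = u n + v` reads the code `⌜W u v⌝`, recodes it
  to `⌜Q + W u v⌝` (`recode`: zig-zag decoding and re-encoding by parity arithmetic, no branch) and
  writes the five cells of the arcs `u_I → v_I` (`⌜2Q⌝`), `u_I → v_J`, `u_J → v_K`, `u_K → v_L`
  (`⌜Q + W u v⌝`) and `u_I → v_L` (`⌜2Q⌝`) — also on the diagonal `u = v`, where they are wrong;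
* **loop B** (`n` iterations, `bodyB`): iteration `u` repairs the diagonal — `u_I → u_I`, `u_J → u_K`,
  `u_K → u_L`, `u_I → u_L` get `0 = ⌜⊤⌝`, `u_I → u_J` gets `⌜2Q⌝` — and writes the arc `u_I → y`
  (`⌜3Q - 1⌝`); every other cell of the block keeps its initial `0 = ⌜⊤⌝`;
* the oracle `query` on `[pQ n, pQ n + N²]`, answer (length `1`, then `⌜radius⌝`) at `pR n`;
* `finishOps`: `mem[1] := (answer word = 6Q - 1)`, `mem[0] := 1` — output `[1]` iff the radius is
  `3Q - 1`.

The data memory during the loops is described in closed form (`heapA`, `heapB`: which iteration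
writes which cell of the query matrix, `famIdx`/`fixIdx`, and with what value, `valA`/`valF`); the
loop bodies are verified against `heapA_succ`, `heapB_succ`, and after both loops cell `(U, V)` of
the query matrix holds `valF W Q U V` (`heapB_final`), identified with the code of the gadget's entry
in `Literature.Computability.FineGrained.NegativeTriangleToRadius`.

## Proof technique

Symbolic execution of straight-line blocks one operation at a time (`execOps_cons_fwd` with the
`merge` register/data normaliser of `Literature.Computability.Cryptography.WordRAMStructuredBlocks`)
and the invariant loop rule `ExecLE.whilenz_invariant`, as in
`Literature.Computability.FineGrained.MinPlusProductToAPSPProgram`.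

## References

* A. Abboud, F. Grandoni, V. Vassilevska Williams, *Subcubic equivalences between graph centrality
  problems, APSP and diameter*, Proc. SODA 2015, 1681–1697, Thm. 1.1, Lemma 2.3.
  doi:10.1137/1.9781611973730.112
* V. Vassilevska Williams, *On some fine-grained questions in algorithms and complexity*, Proc. ICM
  2018, §2, Def. 2.1 (fine-grained reductions on the word RAM).
* T. Nipkow, G. Klein, *Concrete Semantics with Isabelle/HOL*, Springer 2014, §7, §12 (big-step
  semantics, loop invariants).
-/

namespace Literature.Computability.FineGrained.NegTriToRadius

open Cryptography Cryptography.WordRAM Cryptography.WordRAM.SProg Matrix NegTriToAPSP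

/-! ## Memory layout -/

/-- Base of the codes of the relocated input: the code of entry `t` sits at `pC n + t`. [folklore] -/
def pC (n : ℕ) : ℕ := n * n + 103
/-- Header cell of the query block (`N = 4 n + 1`, then the `N²` codes of the gadget row-major). [folklore] -/
def pQ (n : ℕ) : ℕ := 2 * (n * n) + 103
/-- The answer cell (the oracle writes `1`, the answer's length, here and the radius code after it). [folklore] -/
def pR (n : ℕ) : ℕ := 18 * (n * n) + 8 * n + 105
/-- The first cell above everything the program touches. [folklore] -/
def pTop (n : ℕ) : ℕ := 18 * (n * n) + 8 * n + 107

/-- `pC n = n² + 103`. [folklore] -/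
theorem pC_eq (n : ℕ) : pC n = n * n + 103 := rfl
/-- `pQ n = 2 n² + 103`. [folklore] -/
theorem pQ_eq (n : ℕ) : pQ n = 2 * (n * n) + 103 := rfl
/-- `pR n = 18 n² + 8 n + 105 = pQ n + N² + 1`. [folklore] -/
theorem pR_eq (n : ℕ) : pR n = 18 * (n * n) + 8 * n + 105 := rfl
/-- `pTop n = pR n + 2`. [folklore] -/
theorem pTop_eq (n : ℕ) : pTop n = 18 * (n * n) + 8 * n + 107 := rfl

/-- The weight parameter of the gadget for a `NegativeTriangle c` instance of size `n`:
`Q = 2 nᶜ + 2` (so `2M + 1 ≤ Q` for the weight bound `M = nᶜ`). [folklore] -/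
def wQ (n c : ℕ) : ℕ := 2 * n ^ c + 2

/-! ## The recoding of a weight code -/

/-- **The recoding** performed by loop A on a code `c = ⌜z⌝ = encodeInt z + 1` of a finite weight:
with `k = c - 1` (the zig-zag code of `z`), `p = k mod 2` (the sign) and `tt = k + p` (`= 2|z|`),
`recode Q c = (2Q + 1 + tt) - p · tt · 2`, which is `2 (Q + z) + 1 = ⌜Q + z⌝` (`recode_encode`).
[folklore] -/
def recode (Q c : ℕ) : ℕ :=
  2 * Q + 1 + (c - 1 + (c - 1) % 2) - (c - 1) % 2 * (c - 1 + (c - 1) % 2) * 2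

/-- The code of a nonnegative integer `m` is `2 m + 1`. [folklore] -/
theorem encodeWithTopInt_natCast' (m : ℕ) : encodeWithTopInt ((m : ℤ) : WithTop ℤ) = 2 * m + 1 := rfl

/-- The code of the negative integer `-(m + 1)` is `2 m + 2`. [folklore] -/
theorem encodeWithTopInt_negSucc (m : ℕ) : encodeWithTopInt ((Int.negSucc m : ℤ) : WithTop ℤ) = 2 * m + 2 := rfl

/-- **The recoding is correct**: for `|z| ≤ M` and `M + 1 ≤ Q`, `recode Q ⌜z⌝ = ⌜Q + z⌝`. [folklore] -/
theorem recode_encode {Q M : ℕ} {z : ℤ} (hz : |z| ≤ M) (hQ : M + 1 ≤ Q) :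
    recode Q (encodeWithTopInt (z : WithTop ℤ)) = encodeWithTopInt (((Q : ℤ) + z : ℤ) : WithTop ℤ) := by
  rw [abs_le] at hz
  cases z with
  | ofNat m =>
    rw [Int.ofNat_eq_natCast] at hz ⊢
    have e : ((Q : ℤ) + (m : ℤ)) = ((Q + m : ℕ) : ℤ) := by push_cast; ring
    rw [encodeWithTopInt_natCast', e, encodeWithTopInt_natCast']
    unfold recode
    have h1 : (2 * m + 1 - 1) % 2 = 0 := by omega
    rw [h1]
    omega
  | negSucc m =>
    have hm : (m : ℤ) + 1 ≤ M := by
      have := hz.1; rw [Int.negSucc_eq] at this; omega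
    have e : ((Q : ℤ) + Int.negSucc m) = ((Q - (m + 1) : ℕ) : ℤ) := by
      rw [Int.negSucc_eq]; omega
    rw [encodeWithTopInt_negSucc, e, encodeWithTopInt_natCast']
    unfold recode
    have h1 : (2 * m + 2 - 1) % 2 = 1 := by omega
    rw [h1]
    omega

/-- The recoding of a code `≤ 2Q` is `≤ 4Q + 1`. [folklore] -/
theorem recode_le {Q c : ℕ} (hc : c ≤ 2 * Q) : recode Q c ≤ 4 * Q + 1 := by
  unfold recode
  have : c - 1 + (c - 1) % 2 ≤ 2 * Q := by omega
  omega

/-! ## Which iteration writes which cell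

Cells of the `N × N` query matrix (`N = 4 n + 1`) are addressed by `(U, V)`, `U, V < N`; vertex
`ℓ n + a` is copy `ℓ` (`I, J, K, L` for `ℓ = 0, 1, 2, 3`) of `a < n`, vertex `4 n` is `y`. -/

/-- The iteration `t = u n + v` of loop A that writes cell `(U, V)`: the cells of the arcs
`u_I → v_I`, `u_I → v_J`, `u_J → v_K`, `u_K → v_L`, `u_I → v_L`; `n²` (never) for every other cell.
[folklore] -/
def famIdx (n U V : ℕ) : ℕ :=
  if U < n ∧ V < n then U * n + V
  else if U < n ∧ n ≤ V ∧ V < 2 * n then U * n + (V - n)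
  else if n ≤ U ∧ U < 2 * n ∧ 2 * n ≤ V ∧ V < 3 * n then (U - n) * n + (V - 2 * n)
  else if 2 * n ≤ U ∧ U < 3 * n ∧ 3 * n ≤ V ∧ V < 4 * n then (U - 2 * n) * n + (V - 3 * n)
  else if U < n ∧ 3 * n ≤ V ∧ V < 4 * n then U * n + (V - 3 * n)
  else n * n

variable {n : ℕ} (W : Matrix (Fin n) (Fin n) ℤ) (Q : ℕ)

/-- The value loop A writes into cell `(U, V)`: `⌜2Q⌝ = 4Q + 1` on the arcs `u_I → v_I` and
`u_I → v_L`, the recoded weight `⌜Q + W u v⌝` on `u_I → v_J`, `u_J → v_K`, `u_K → v_L` (including the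
diagonal `u = v`, repaired by loop B), `0` elsewhere. [folklore] -/
def valA (U V : ℕ) : ℕ :=
  if U < n ∧ V < n then 4 * Q + 1
  else if U < n ∧ n ≤ V ∧ V < 2 * n then recode Q (code W (U * n + (V - n)))
  else if n ≤ U ∧ U < 2 * n ∧ 2 * n ≤ V ∧ V < 3 * n then recode Q (code W ((U - n) * n + (V - 2 * n)))
  else if 2 * n ≤ U ∧ U < 3 * n ∧ 3 * n ≤ V ∧ V < 4 * n then
    recode Q (code W ((U - 2 * n) * n + (V - 3 * n)))
  else if U < n ∧ 3 * n ≤ V ∧ V < 4 * n then 4 * Q + 1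
  else 0

/-- The iteration `u` of loop B that (re)writes cell `(U, V)`: the diagonal cells `u_I → u_I`,
`u_I → u_J`, `u_J → u_K`, `u_K → u_L`, `u_I → u_L` and the cell `u_I → y`; `n` (never) otherwise.
[folklore] -/
def fixIdx (n U V : ℕ) : ℕ :=
  if U < n ∧ V = U then U
  else if U < n ∧ V = n + U then U
  else if n ≤ U ∧ U < 2 * n ∧ V = n + U then U - n
  else if 2 * n ≤ U ∧ U < 3 * n ∧ V = n + U then U - 2 * n
  else if U < n ∧ V = 3 * n + U then U
  else if U < n ∧ V = 4 * n then U
  else n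

/-- **The final content of cell `(U, V)`** of the query matrix: the code of the gadget's entry —
`⌜2Q⌝` on `u_I → v_I` (`u ≠ v`), `⌜Q + W u v⌝` on `u_I → v_J` (`u ≠ v`) and `⌜2Q⌝` on `u_I → u_J`,
`⌜Q + W u v⌝` on `u_J → v_K` and `u_K → v_L` (`u ≠ v`), `⌜2Q⌝` on `u_I → v_L` (`u ≠ v`), `⌜3Q - 1⌝`
on `u_I → y`, and `0 = ⌜⊤⌝` elsewhere (see `Literature.Computability.Cryptography.radiusGadgetEntry`).
[folklore] -/
def valF (U V : ℕ) : ℕ :=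
  if U < n then
    if V < n then (if U = V then 0 else 4 * Q + 1)
    else if V < 2 * n then (if U + n = V then 4 * Q + 1 else recode Q (code W (U * n + (V - n))))
    else if V < 3 * n then 0
    else if V < 4 * n then (if U + 3 * n = V then 0 else 4 * Q + 1)
    else 6 * Q - 1
  else if U < 2 * n then
    (if 2 * n ≤ V ∧ V < 3 * n ∧ U + n ≠ V then recode Q (code W ((U - n) * n + (V - 2 * n))) else 0)
  else if U < 3 * n then
    (if 3 * n ≤ V ∧ V < 4 * n ∧ U + n ≠ V then recode Q (code W ((U - 2 * n) * n + (V - 3 * n)))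
      else 0)
  else 0

/-! ## The data memory during the loops -/

/-- `IsCell n a`: address `a` is a cell of the query matrix. [folklore] -/
def IsCell (n a : ℕ) : Prop := pQ n + 1 ≤ a ∧ a < pQ n + 1 + (4 * n + 1) * (4 * n + 1)

/-- `IsCell` is decidable (a conjunction of inequalities). [folklore] -/
instance (n a : ℕ) : Decidable (IsCell n a) :=
  inferInstanceAs (Decidable (pQ n + 1 ≤ a ∧ a < pQ n + 1 + (4 * n + 1) * (4 * n + 1)))

/-- The row of the cell at address `a`. [folklore] -/
def rowOf (n a : ℕ) : ℕ := (a - (pQ n + 1)) / (4 * n + 1)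
/-- The column of the cell at address `a`. [folklore] -/
def colOf (n a : ℕ) : ℕ := (a - (pQ n + 1)) % (4 * n + 1)

/-- **The data memory after `t` iterations of loop A** over the data `H₁` left by the setup (which is
`0` on the cells): cell `(U, V)` holds `valA` if its iteration `famIdx` has run, `0` otherwise;
everything else is `H₁`. [folklore] -/
def heapA (H₁ : ℕ → ℕ) (t : ℕ) (a : ℕ) : ℕ :=
  if IsCell n a then (if famIdx n (rowOf n a) (colOf n a) < t then valA W Q (rowOf n a) (colOf n a) else 0)
  else H₁ a

/-- **The data memory after `s` iterations of loop B**: cell `(U, V)` holds `valF` if its repair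
iteration `fixIdx` has run, its loop-A content `valA` otherwise. [folklore] -/
def heapB (H₁ : ℕ → ℕ) (s : ℕ) (a : ℕ) : ℕ :=
  if IsCell n a then
    (if fixIdx n (rowOf n a) (colOf n a) < s then valF W Q (rowOf n a) (colOf n a)
      else valA W Q (rowOf n a) (colOf n a))
  else H₁ a

/-! ### Decoding cells -/

/-- Row-major pairs with small second components are equal iff componentwise equal. [folklore] -/
theorem mul_add_eq_iff {N a b a' b' : ℕ} (hb : b < N) (hb' : b' < N) :
    a * N + b = a' * N + b' ↔ a = a' ∧ b = b' := by
  constructor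
  · intro h
    have h1 : (a * N + b) / N = (a' * N + b') / N := by rw [h]
    rw [div_of_mul_add hb, div_of_mul_add hb'] at h1
    subst h1
    exact ⟨rfl, by omega⟩
  · rintro ⟨rfl, rfl⟩; rfl

/-- The cell at `pQ n + 1 + (U N + V)` (`V < N`) has row `U` and column `V`. [folklore] -/
theorem rowOf_colOf {U V : ℕ} (hV : V < 4 * n + 1) :
    rowOf n (pQ n + 1 + (U * (4 * n + 1) + V)) = U ∧ colOf n (pQ n + 1 + (U * (4 * n + 1) + V)) = V := by
  unfold rowOf colOf
  rw [Nat.add_sub_cancel_left, div_of_mul_add hV, Nat.mul_add_mod_of_lt hV]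
  exact ⟨rfl, rfl⟩

/-- Every cell address decomposes as `pQ n + 1 + (rowOf · N + colOf)` with `colOf < N` and
`rowOf < N`. [folklore] -/
theorem cell_decomp {a : ℕ} (ha : IsCell n a) :
    a = pQ n + 1 + (rowOf n a * (4 * n + 1) + colOf n a) ∧ colOf n a < 4 * n + 1 ∧ rowOf n a < 4 * n + 1 := by
  obtain ⟨h1, h2⟩ := ha
  refine ⟨?_, Nat.mod_lt _ (by omega), Nat.div_lt_of_lt_mul (by omega)⟩
  unfold rowOf colOf
  have := Nat.div_add_mod' (a - (pQ n + 1)) (4 * n + 1)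
  omega

/-- `pQ n + 1 + (U N + V)` is a cell for `U, V < N`. [folklore] -/
theorem isCell_of_lt {U V : ℕ} (hU : U < 4 * n + 1) (hV : V < 4 * n + 1) :
    IsCell n (pQ n + 1 + (U * (4 * n + 1) + V)) :=
  ⟨by omega, by have := mul_add_lt_mul hU hV; omega⟩

/-- Reading a closed-form heap at a cell. [folklore] -/
theorem heapA_cell (H₁ : ℕ → ℕ) (t : ℕ) {U V : ℕ} (hU : U < 4 * n + 1) (hV : V < 4 * n + 1) :
    heapA W Q H₁ t (pQ n + 1 + (U * (4 * n + 1) + V)) = if famIdx n U V < t then valA W Q U V else 0 := by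
  unfold heapA
  rw [if_pos (isCell_of_lt hU hV), (rowOf_colOf hV).1, (rowOf_colOf hV).2]

/-- Reading `heapB` at a cell. [folklore] -/
theorem heapB_cell (H₁ : ℕ → ℕ) (s : ℕ) {U V : ℕ} (hU : U < 4 * n + 1) (hV : V < 4 * n + 1) :
    heapB W Q H₁ s (pQ n + 1 + (U * (4 * n + 1) + V)) =
      if fixIdx n U V < s then valF W Q U V else valA W Q U V := by
  unfold heapB
  rw [if_pos (isCell_of_lt hU hV), (rowOf_colOf hV).1, (rowOf_colOf hV).2]

/-- Outside the cells both heaps are the setup data. [folklore] -/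
theorem heapA_of_not (H₁ : ℕ → ℕ) (t : ℕ) {a : ℕ} (ha : ¬ IsCell n a) : heapA W Q H₁ t a = H₁ a := by
  unfold heapA; rw [if_neg ha]

/-- Outside the cells both heaps are the setup data. [folklore] -/
theorem heapB_of_not (H₁ : ℕ → ℕ) (s : ℕ) {a : ℕ} (ha : ¬ IsCell n a) : heapB W Q H₁ s a = H₁ a := by
  unfold heapB; rw [if_neg ha]

/-- Before loop A the heap is the setup data, provided the cells are `0` there. [folklore] -/
theorem heapA_zero (H₁ : ℕ → ℕ) (h0 : ∀ a, IsCell n a → H₁ a = 0) : heapA W Q H₁ 0 = H₁ := by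
  funext a
  unfold heapA
  split_ifs with h h'
  · omega
  · exact (h0 a h).symm
  · rfl

/-! ### One iteration of loop A in closed form -/

/-- The cells written in iteration `t = u n + v` of loop A are exactly those with `famIdx = t`.
[folklore] -/
theorem famIdx_eq_iff {t u v U V : ℕ} (ht : t < n * n) (htu : t = u * n + v) (hv : v < n)
    (hU : U < 4 * n + 1) (hV : V < 4 * n + 1) :
    famIdx n U V = t ↔ (U = u ∧ V = v) ∨ (U = u ∧ V = n + v) ∨ (U = n + u ∧ V = 2 * n + v) ∨
      (U = 2 * n + u ∧ V = 3 * n + v) ∨ (U = u ∧ V = 3 * n + v) := by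
  have hu : u < n := by
    by_contra hun
    have : n * n ≤ u * n := Nat.mul_le_mul_right n (Nat.not_lt.1 hun)
    omega
  unfold famIdx
  constructor
  · intro h
    split_ifs at h with h1 h2 h3 h4 h5
    · rw [htu, mul_add_eq_iff h1.2 hv] at h
      exact Or.inl h
    · rw [htu, mul_add_eq_iff (by omega) hv] at h
      exact Or.inr (Or.inl ⟨h.1, by omega⟩)
    · rw [htu, mul_add_eq_iff (by omega) hv] at h
      exact Or.inr (Or.inr (Or.inl ⟨by omega, by omega⟩))
    · rw [htu, mul_add_eq_iff (by omega) hv] at h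
      exact Or.inr (Or.inr (Or.inr (Or.inl ⟨by omega, by omega⟩)))
    · rw [htu, mul_add_eq_iff (by omega) hv] at h
      exact Or.inr (Or.inr (Or.inr (Or.inr ⟨h.1, by omega⟩)))
    · omega
  · rintro (⟨rfl, rfl⟩ | ⟨rfl, rfl⟩ | ⟨rfl, rfl⟩ | ⟨rfl, rfl⟩ | ⟨rfl, rfl⟩)
    · rw [if_pos ⟨hu, hv⟩, htu]
    · rw [if_neg (by omega), if_pos ⟨hu, by omega, by omega⟩, htu, Nat.add_sub_cancel_left]
    · rw [if_neg (by omega), if_neg (by omega), if_pos ⟨by omega, by omega, by omega, by omega⟩, htu,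
        Nat.add_sub_cancel_left, Nat.add_sub_cancel_left]
    · rw [if_neg (by omega), if_neg (by omega), if_neg (by omega),
        if_pos ⟨by omega, by omega, by omega, by omega⟩, htu, Nat.add_sub_cancel_left,
        Nat.add_sub_cancel_left]
    · rw [if_neg (by omega), if_neg (by omega), if_neg (by omega), if_neg (by omega),
        if_pos ⟨hu, by omega, by omega⟩, htu, Nat.add_sub_cancel_left]

/-- **One iteration of loop A, in closed form.** Iteration `t = u n + v` turns `heapA t` into
`heapA (t + 1)` by the five writes of `bodyA` (addresses in the syntactic form the symbolic execution
produces: `d₁ = u N + v + (pQ n + 1)`, then `d₁ + n`, `d₁ + (n N + 2 n)`, `d₁ + (n N · 2 + 3 n)`,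
`d₁ + 3 n`). [folklore] -/
theorem heapA_succ (H₁ : ℕ → ℕ) {t u v : ℕ} (ht : t < n * n) (htu : t = u * n + v) (hv : v < n) :
    heapA W Q H₁ (t + 1) =
      Function.update (Function.update (Function.update (Function.update (Function.update
        (heapA W Q H₁ t)
        (u * (4 * n + 1) + v + (pQ n + 1)) (4 * Q + 1))
        (u * (4 * n + 1) + v + (pQ n + 1) + n) (recode Q (code W t)))
        (u * (4 * n + 1) + v + (pQ n + 1) + (n * (4 * n + 1) + 2 * n)) (recode Q (code W t)))
        (u * (4 * n + 1) + v + (pQ n + 1) + (n * (4 * n + 1) * 2 + 3 * n)) (recode Q (code W t)))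
        (u * (4 * n + 1) + v + (pQ n + 1) + 3 * n) (4 * Q + 1) := by
  have hu : u < n := by
    by_contra hun
    have : n * n ≤ u * n := Nat.mul_le_mul_right n (Nat.not_lt.1 hun)
    omega
  -- the five addresses in row-major form
  have e1 : u * (4 * n + 1) + v + (pQ n + 1) = pQ n + 1 + (u * (4 * n + 1) + v) := by omega
  have e2 : u * (4 * n + 1) + v + (pQ n + 1) + n = pQ n + 1 + (u * (4 * n + 1) + (n + v)) := by omega
  have e3 : u * (4 * n + 1) + v + (pQ n + 1) + (n * (4 * n + 1) + 2 * n) =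
      pQ n + 1 + ((n + u) * (4 * n + 1) + (2 * n + v)) := by rw [Nat.add_mul]; omega
  have e4 : u * (4 * n + 1) + v + (pQ n + 1) + (n * (4 * n + 1) * 2 + 3 * n) =
      pQ n + 1 + ((2 * n + u) * (4 * n + 1) + (3 * n + v)) := by
    have : (2 * n + u) * (4 * n + 1) = n * (4 * n + 1) * 2 + u * (4 * n + 1) := by ring
    rw [this]; omega
  have e5 : u * (4 * n + 1) + v + (pQ n + 1) + 3 * n = pQ n + 1 + (u * (4 * n + 1) + (3 * n + v)) := by
    omega
  rw [e5, e4, e3, e2, e1]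
  funext a
  by_cases ha : IsCell n a
  · obtain ⟨hae, hVlt, hUlt⟩ := cell_decomp ha
    generalize hUg : rowOf n a = U at hae hUlt
    generalize hVg : colOf n a = V at hae hVlt
    subst hae
    simp only [heapA_cell W Q H₁ t hUlt hVlt, heapA_cell W Q H₁ (t + 1) hUlt hVlt, Function.update_apply]
    -- address comparisons reduce to `(U, V)` comparisons
    have c1 : (pQ n + 1 + (U * (4 * n + 1) + V) = pQ n + 1 + (u * (4 * n + 1) + v)) ↔ (U = u ∧ V = v) := by
      rw [Nat.add_left_cancel_iff, mul_add_eq_iff hVlt (by omega)]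
    have c2 : (pQ n + 1 + (U * (4 * n + 1) + V) = pQ n + 1 + (u * (4 * n + 1) + (n + v))) ↔
        (U = u ∧ V = n + v) := by
      rw [Nat.add_left_cancel_iff, mul_add_eq_iff hVlt (by omega)]
    have c3 : (pQ n + 1 + (U * (4 * n + 1) + V) = pQ n + 1 + ((n + u) * (4 * n + 1) + (2 * n + v))) ↔
        (U = n + u ∧ V = 2 * n + v) := by
      rw [Nat.add_left_cancel_iff, mul_add_eq_iff hVlt (by omega)]
    have c4 : (pQ n + 1 + (U * (4 * n + 1) + V) = pQ n + 1 + ((2 * n + u) * (4 * n + 1) + (3 * n + v))) ↔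
        (U = 2 * n + u ∧ V = 3 * n + v) := by
      rw [Nat.add_left_cancel_iff, mul_add_eq_iff hVlt (by omega)]
    have c5 : (pQ n + 1 + (U * (4 * n + 1) + V) = pQ n + 1 + (u * (4 * n + 1) + (3 * n + v))) ↔
        (U = u ∧ V = 3 * n + v) := by
      rw [Nat.add_left_cancel_iff, mul_add_eq_iff hVlt (by omega)]
    simp only [c1, c2, c3, c4, c5]
    have hfam := famIdx_eq_iff (U := U) (V := V) ht htu hv hUlt hVlt
    by_cases hft : famIdx n U V = t
    · -- a cell written in this iteration
      have hcases := hfam.1 hft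
      rw [if_pos (by omega)]
      rcases hcases with ⟨rfl, rfl⟩ | ⟨rfl, rfl⟩ | ⟨rfl, rfl⟩ | ⟨rfl, rfl⟩ | ⟨rfl, rfl⟩
      · rw [if_neg (by omega), if_neg (by omega), if_neg (by omega), if_neg (by omega), if_pos ⟨rfl, rfl⟩]
        unfold valA; rw [if_pos ⟨hu, hv⟩]
      · rw [if_neg (by omega), if_neg (by omega), if_neg (by omega), if_pos ⟨rfl, rfl⟩]
        unfold valA; rw [if_neg (by omega), if_pos ⟨hu, by omega, by omega⟩, Nat.add_sub_cancel_left, ← htu]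
      · rw [if_neg (by omega), if_neg (by omega), if_pos ⟨rfl, rfl⟩]
        unfold valA
        rw [if_neg (by omega), if_neg (by omega), if_pos ⟨by omega, by omega, by omega, by omega⟩,
          Nat.add_sub_cancel_left, Nat.add_sub_cancel_left, ← htu]
      · rw [if_neg (by omega), if_pos ⟨rfl, rfl⟩]
        unfold valA
        rw [if_neg (by omega), if_neg (by omega), if_neg (by omega),
          if_pos ⟨by omega, by omega, by omega, by omega⟩, Nat.add_sub_cancel_left,
          Nat.add_sub_cancel_left, ← htu]
      · rw [if_pos ⟨rfl, rfl⟩]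
        unfold valA
        rw [if_neg (by omega), if_neg (by omega), if_neg (by omega), if_neg (by omega),
          if_pos ⟨hu, by omega, by omega⟩]
    · -- a cell of another iteration: untouched, and `famIdx < t + 1 ↔ famIdx < t`
      have hne : ¬ ((U = u ∧ V = v) ∨ (U = u ∧ V = n + v) ∨ (U = n + u ∧ V = 2 * n + v) ∨
          (U = 2 * n + u ∧ V = 3 * n + v) ∨ (U = u ∧ V = 3 * n + v)) := fun h => hft (hfam.2 h)
      rw [if_neg (fun h => hne (Or.inr (Or.inr (Or.inr (Or.inr h))))),
        if_neg (fun h => hne (Or.inr (Or.inr (Or.inr (Or.inl h))))),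
        if_neg (fun h => hne (Or.inr (Or.inr (Or.inl h)))), if_neg (fun h => hne (Or.inr (Or.inl h))),
        if_neg (fun h => hne (Or.inl h))]
      by_cases hlt : famIdx n U V < t
      · rw [if_pos (by omega), if_pos hlt]
      · rw [if_neg (by omega), if_neg hlt]
  · -- not a cell: untouched
    have hc : ∀ {U' V' : ℕ}, U' < 4 * n + 1 → V' < 4 * n + 1 → a ≠ pQ n + 1 + (U' * (4 * n + 1) + V') :=
      fun hU' hV' h => ha (h ▸ isCell_of_lt hU' hV')
    rw [heapA_of_not W Q H₁ _ ha,
      Function.update_of_ne (hc (U' := u) (V' := 3 * n + v) (by omega) (by omega)),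
      Function.update_of_ne (hc (U' := 2 * n + u) (V' := 3 * n + v) (by omega) (by omega)),
      Function.update_of_ne (hc (U' := n + u) (V' := 2 * n + v) (by omega) (by omega)),
      Function.update_of_ne (hc (U' := u) (V' := n + v) (by omega) (by omega)),
      Function.update_of_ne (hc (U' := u) (V' := v) (by omega) (by omega)), heapA_of_not W Q H₁ _ ha]

/-! ### One iteration of loop B in closed form -/

/-- The cells written in iteration `u` of loop B are exactly those with `fixIdx = u`. [folklore] -/
theorem fixIdx_eq_iff {u U V : ℕ} (hu : u < n) (hU : U < 4 * n + 1) (hV : V < 4 * n + 1) :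
    fixIdx n U V = u ↔ (U = u ∧ V = u) ∨ (U = u ∧ V = n + u) ∨ (U = n + u ∧ V = 2 * n + u) ∨
      (U = 2 * n + u ∧ V = 3 * n + u) ∨ (U = u ∧ V = 3 * n + u) ∨ (U = u ∧ V = 4 * n) := by
  unfold fixIdx
  constructor
  · intro h
    split_ifs at h <;> omega
  · rintro (⟨rfl, rfl⟩ | ⟨rfl, rfl⟩ | ⟨rfl, rfl⟩ | ⟨rfl, rfl⟩ | ⟨rfl, rfl⟩ | ⟨rfl, rfl⟩)
    · rw [if_pos ⟨hu, rfl⟩]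
    · rw [if_neg (by omega), if_pos ⟨hu, rfl⟩]
    · rw [if_neg (by omega), if_neg (by omega), if_pos ⟨by omega, by omega, by omega⟩]; omega
    · rw [if_neg (by omega), if_neg (by omega), if_neg (by omega), if_pos ⟨by omega, by omega, by omega⟩]
      omega
    · rw [if_neg (by omega), if_neg (by omega), if_neg (by omega), if_neg (by omega), if_pos ⟨hu, rfl⟩]
    · rw [if_neg (by omega), if_neg (by omega), if_neg (by omega), if_neg (by omega), if_neg (by omega),
        if_pos ⟨hu, rfl⟩]

/-- The values written by loop B are the final ones. [folklore] -/
theorem valF_fix {u U V : ℕ} (hu : u < n) :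
    ((U = u ∧ V = u) → valF W Q U V = 0) ∧ ((U = u ∧ V = n + u) → valF W Q U V = 4 * Q + 1) ∧
      ((U = n + u ∧ V = 2 * n + u) → valF W Q U V = 0) ∧
      ((U = 2 * n + u ∧ V = 3 * n + u) → valF W Q U V = 0) ∧
      ((U = u ∧ V = 3 * n + u) → valF W Q U V = 0) ∧ ((U = u ∧ V = 4 * n) → valF W Q U V = 6 * Q - 1) := by
  unfold valF
  refine ⟨?_, ?_, ?_, ?_, ?_, ?_⟩ <;> rintro ⟨rfl, rfl⟩
  · rw [if_pos hu, if_pos hu, if_pos rfl]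
  · rw [if_pos hu, if_neg (by omega), if_pos (by omega), if_pos (by omega)]
  · rw [if_neg (by omega), if_pos (by omega), if_neg (by omega)]
  · rw [if_neg (by omega), if_neg (by omega), if_pos (by omega), if_neg (by omega)]
  · rw [if_pos hu, if_neg (by omega), if_neg (by omega), if_neg (by omega), if_pos (by omega), if_pos (by omega)]
  · rw [if_pos hu, if_neg (by omega), if_neg (by omega), if_neg (by omega), if_neg (by omega)]

/-- **One iteration of loop B, in closed form.** Iteration `u` turns `heapB u` into `heapB (u + 1)`
by the six writes of `bodyB` (addresses in the syntactic form the symbolic execution produces, from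
the row start `r = u N + (pQ n + 1)`: `r + u`, `r + u + n`, `r + u + (n N + 2 n)`,
`r + u + (n N · 2 + 3 n)`, `r + u + 3 n`, `r + 4 n`). [folklore] -/
theorem heapB_succ (H₁ : ℕ → ℕ) {u : ℕ} (hu : u < n) :
    heapB W Q H₁ (u + 1) =
      Function.update (Function.update (Function.update (Function.update (Function.update
        (Function.update (heapB W Q H₁ u)
        (u * (4 * n + 1) + (pQ n + 1) + u) 0)
        (u * (4 * n + 1) + (pQ n + 1) + u + n) (4 * Q + 1))
        (u * (4 * n + 1) + (pQ n + 1) + u + (n * (4 * n + 1) + 2 * n)) 0)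
        (u * (4 * n + 1) + (pQ n + 1) + u + (n * (4 * n + 1) * 2 + 3 * n)) 0)
        (u * (4 * n + 1) + (pQ n + 1) + u + 3 * n) 0)
        (u * (4 * n + 1) + (pQ n + 1) + 4 * n) (6 * Q - 1) := by
  have e1 : u * (4 * n + 1) + (pQ n + 1) + u = pQ n + 1 + (u * (4 * n + 1) + u) := by omega
  have e2 : u * (4 * n + 1) + (pQ n + 1) + u + n = pQ n + 1 + (u * (4 * n + 1) + (n + u)) := by omega
  have e3 : u * (4 * n + 1) + (pQ n + 1) + u + (n * (4 * n + 1) + 2 * n) =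
      pQ n + 1 + ((n + u) * (4 * n + 1) + (2 * n + u)) := by rw [Nat.add_mul]; omega
  have e4 : u * (4 * n + 1) + (pQ n + 1) + u + (n * (4 * n + 1) * 2 + 3 * n) =
      pQ n + 1 + ((2 * n + u) * (4 * n + 1) + (3 * n + u)) := by
    have : (2 * n + u) * (4 * n + 1) = n * (4 * n + 1) * 2 + u * (4 * n + 1) := by ring
    rw [this]; omega
  have e5 : u * (4 * n + 1) + (pQ n + 1) + u + 3 * n = pQ n + 1 + (u * (4 * n + 1) + (3 * n + u)) := by
    omega
  have e6 : u * (4 * n + 1) + (pQ n + 1) + 4 * n = pQ n + 1 + (u * (4 * n + 1) + 4 * n) := by omega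
  rw [e6, e5, e4, e3, e2, e1]
  funext a
  by_cases ha : IsCell n a
  · obtain ⟨hae, hVlt, hUlt⟩ := cell_decomp ha
    generalize hUg : rowOf n a = U at hae hUlt
    generalize hVg : colOf n a = V at hae hVlt
    subst hae
    simp only [heapB_cell W Q H₁ u hUlt hVlt, heapB_cell W Q H₁ (u + 1) hUlt hVlt, Function.update_apply]
    have c1 : (pQ n + 1 + (U * (4 * n + 1) + V) = pQ n + 1 + (u * (4 * n + 1) + u)) ↔ (U = u ∧ V = u) := by
      rw [Nat.add_left_cancel_iff, mul_add_eq_iff hVlt (by omega)]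
    have c2 : (pQ n + 1 + (U * (4 * n + 1) + V) = pQ n + 1 + (u * (4 * n + 1) + (n + u))) ↔
        (U = u ∧ V = n + u) := by
      rw [Nat.add_left_cancel_iff, mul_add_eq_iff hVlt (by omega)]
    have c3 : (pQ n + 1 + (U * (4 * n + 1) + V) = pQ n + 1 + ((n + u) * (4 * n + 1) + (2 * n + u))) ↔
        (U = n + u ∧ V = 2 * n + u) := by
      rw [Nat.add_left_cancel_iff, mul_add_eq_iff hVlt (by omega)]
    have c4 : (pQ n + 1 + (U * (4 * n + 1) + V) = pQ n + 1 + ((2 * n + u) * (4 * n + 1) + (3 * n + u))) ↔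
        (U = 2 * n + u ∧ V = 3 * n + u) := by
      rw [Nat.add_left_cancel_iff, mul_add_eq_iff hVlt (by omega)]
    have c5 : (pQ n + 1 + (U * (4 * n + 1) + V) = pQ n + 1 + (u * (4 * n + 1) + (3 * n + u))) ↔
        (U = u ∧ V = 3 * n + u) := by
      rw [Nat.add_left_cancel_iff, mul_add_eq_iff hVlt (by omega)]
    have c6 : (pQ n + 1 + (U * (4 * n + 1) + V) = pQ n + 1 + (u * (4 * n + 1) + 4 * n)) ↔
        (U = u ∧ V = 4 * n) := by
      rw [Nat.add_left_cancel_iff, mul_add_eq_iff hVlt (by omega)]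
    simp only [c1, c2, c3, c4, c5, c6]
    have hfix := fixIdx_eq_iff (U := U) (V := V) hu hUlt hVlt
    obtain ⟨f1, f2, f3, f4, f5, f6⟩ := valF_fix W Q (u := u) (U := U) (V := V) hu
    by_cases hft : fixIdx n U V = u
    · have hcases := hfix.1 hft
      rw [if_pos (by omega)]
      rcases hcases with h | h | h | h | h | h
      · rw [if_neg (by omega), if_neg (by omega), if_neg (by omega), if_neg (by omega), if_neg (by omega),
          if_pos h, f1 h]
      · rw [if_neg (by omega), if_neg (by omega), if_neg (by omega), if_neg (by omega), if_pos h, f2 h]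
      · rw [if_neg (by omega), if_neg (by omega), if_neg (by omega), if_pos h, f3 h]
      · rw [if_neg (by omega), if_neg (by omega), if_pos h, f4 h]
      · rw [if_neg (by omega), if_pos h, f5 h]
      · rw [if_pos h, f6 h]
    · have hne : ¬ ((U = u ∧ V = u) ∨ (U = u ∧ V = n + u) ∨ (U = n + u ∧ V = 2 * n + u) ∨
          (U = 2 * n + u ∧ V = 3 * n + u) ∨ (U = u ∧ V = 3 * n + u) ∨ (U = u ∧ V = 4 * n)) :=
        fun h => hft (hfix.2 h)
      rw [if_neg (fun h => hne (Or.inr (Or.inr (Or.inr (Or.inr (Or.inr h)))))),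
        if_neg (fun h => hne (Or.inr (Or.inr (Or.inr (Or.inr (Or.inl h)))))),
        if_neg (fun h => hne (Or.inr (Or.inr (Or.inr (Or.inl h))))),
        if_neg (fun h => hne (Or.inr (Or.inr (Or.inl h)))), if_neg (fun h => hne (Or.inr (Or.inl h))),
        if_neg (fun h => hne (Or.inl h))]
      by_cases hlt : fixIdx n U V < u
      · rw [if_pos (by omega), if_pos hlt]
      · rw [if_neg (by omega), if_neg hlt]
  · have hc : ∀ {U' V' : ℕ}, U' < 4 * n + 1 → V' < 4 * n + 1 → a ≠ pQ n + 1 + (U' * (4 * n + 1) + V') :=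
      fun hU' hV' h => ha (h ▸ isCell_of_lt hU' hV')
    rw [heapB_of_not W Q H₁ _ ha,
      Function.update_of_ne (hc (U' := u) (V' := 4 * n) (by omega) (by omega)),
      Function.update_of_ne (hc (U' := u) (V' := 3 * n + u) (by omega) (by omega)),
      Function.update_of_ne (hc (U' := 2 * n + u) (V' := 3 * n + u) (by omega) (by omega)),
      Function.update_of_ne (hc (U' := n + u) (V' := 2 * n + u) (by omega) (by omega)),
      Function.update_of_ne (hc (U' := u) (V' := n + u) (by omega) (by omega)),
      Function.update_of_ne (hc (U' := u) (V' := u) (by omega) (by omega)), heapB_of_not W Q H₁ _ ha]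

/-! ### The loops end to end -/

/-- A cell no iteration of loop A writes holds `0` in `valA` as well. [folklore] -/
theorem valA_eq_zero_of_le {U V : ℕ} (h : n * n ≤ famIdx n U V) : valA W Q U V = 0 := by
  unfold famIdx at h
  unfold valA
  split_ifs at h with h1 h2 h3 h4 h5
  · exact absurd (mul_add_lt_mul h1.1 h1.2) (by omega)
  · exact absurd (mul_add_lt_mul h2.1 (show V - n < n by omega)) (by omega)
  · exact absurd (mul_add_lt_mul (show U - n < n by omega) (show V - 2 * n < n by omega)) (by omega)
  · exact absurd (mul_add_lt_mul (show U - 2 * n < n by omega) (show V - 3 * n < n by omega)) (by omega)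
  · exact absurd (mul_add_lt_mul h5.1 (show V - 3 * n < n by omega)) (by omega)
  · rw [if_neg h1, if_neg h2, if_neg h3, if_neg h4, if_neg h5]

/-- After loop A (`n²` iterations) the heap is `heapB 0`. [folklore] -/
theorem heapA_final (H₁ : ℕ → ℕ) : heapA W Q H₁ (n * n) = heapB W Q H₁ 0 := by
  funext a
  unfold heapA heapB
  split_ifs with h1 h2 h3 <;> first
    | rfl
    | omega
    | exact (valA_eq_zero_of_le W Q (Nat.not_lt.1 h2)).symm

/-- `fixIdx ≤ n`. [folklore] -/
theorem fixIdx_le (U V : ℕ) : fixIdx n U V ≤ n := by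
  unfold fixIdx; split_ifs <;> omega

/-- Untouched by loop B, a cell already holds its final value after loop A. [folklore] -/
theorem valA_eq_valF_of_fixIdx {U V : ℕ} (hU : U < 4 * n + 1) (hV : V < 4 * n + 1)
    (h : fixIdx n U V = n) : valA W Q U V = valF W Q U V := by
  have hx : ∀ u, u < n → ¬ ((U = u ∧ V = u) ∨ (U = u ∧ V = n + u) ∨ (U = n + u ∧ V = 2 * n + u) ∨
      (U = 2 * n + u ∧ V = 3 * n + u) ∨ (U = u ∧ V = 3 * n + u) ∨ (U = u ∧ V = 4 * n)) :=
    fun u hu hc => by have := (fixIdx_eq_iff hu hU hV).2 hc; omega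
  unfold valA valF
  by_cases hU1 : U < n
  · have hxU := hx U hU1
    rw [if_pos hU1]
    by_cases hV1 : V < n
    · have hne : ¬ U = V := fun e => hxU (Or.inl ⟨rfl, e.symm⟩)
      rw [if_pos ⟨hU1, hV1⟩, if_pos hV1, if_neg hne]
    have nA1 : ¬ (U < n ∧ V < n) := fun h => hV1 h.2
    rw [if_neg nA1, if_neg hV1]
    by_cases hV2 : V < 2 * n
    · have hne : ¬ U + n = V := fun e => hxU (Or.inr (Or.inl ⟨rfl, by omega⟩))
      rw [if_pos ⟨hU1, Nat.not_lt.1 hV1, hV2⟩, if_pos hV2, if_neg hne]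
    have nA2 : ¬ (U < n ∧ n ≤ V ∧ V < 2 * n) := fun h => hV2 h.2.2
    have nA3 : ¬ (n ≤ U ∧ U < 2 * n ∧ 2 * n ≤ V ∧ V < 3 * n) := fun h => by omega
    have nA4 : ¬ (2 * n ≤ U ∧ U < 3 * n ∧ 3 * n ≤ V ∧ V < 4 * n) := fun h => by omega
    rw [if_neg nA2, if_neg nA3, if_neg nA4, if_neg hV2]
    by_cases hV3 : V < 3 * n
    · have nA5 : ¬ (U < n ∧ 3 * n ≤ V ∧ V < 4 * n) := fun h => by omega
      rw [if_neg nA5, if_pos hV3]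
    rw [if_neg hV3]
    by_cases hV4 : V < 4 * n
    · have hne : ¬ U + 3 * n = V :=
        fun e => hxU (Or.inr (Or.inr (Or.inr (Or.inr (Or.inl ⟨rfl, by omega⟩)))))
      rw [if_pos ⟨hU1, Nat.not_lt.1 hV3, hV4⟩, if_pos hV4, if_neg hne]
    · exact absurd (Or.inr (Or.inr (Or.inr (Or.inr (Or.inr ⟨rfl, by omega⟩))))) hxU
  have nA1 : ¬ (U < n ∧ V < n) := fun h => hU1 h.1
  have nA2 : ¬ (U < n ∧ n ≤ V ∧ V < 2 * n) := fun h => hU1 h.1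
  have nA5 : ¬ (U < n ∧ 3 * n ≤ V ∧ V < 4 * n) := fun h => hU1 h.1
  rw [if_neg nA1, if_neg nA2, if_neg hU1]
  by_cases hU2 : U < 2 * n
  · have hxU := hx (U - n) (by omega)
    have nA4 : ¬ (2 * n ≤ U ∧ U < 3 * n ∧ 3 * n ≤ V ∧ V < 4 * n) := fun h => by omega
    rw [if_pos hU2]
    by_cases hVr : 2 * n ≤ V ∧ V < 3 * n
    · have hne : U + n ≠ V := fun e => hxU (Or.inr (Or.inr (Or.inl ⟨by omega, by omega⟩)))
      rw [if_pos ⟨Nat.not_lt.1 hU1, hU2, hVr.1, hVr.2⟩, if_pos ⟨hVr.1, hVr.2, hne⟩]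
    · have nA3 : ¬ (n ≤ U ∧ U < 2 * n ∧ 2 * n ≤ V ∧ V < 3 * n) := fun h => hVr ⟨h.2.2.1, h.2.2.2⟩
      have nF : ¬ (2 * n ≤ V ∧ V < 3 * n ∧ U + n ≠ V) := fun h => hVr ⟨h.1, h.2.1⟩
      rw [if_neg nA3, if_neg nA4, if_neg nA5, if_neg nF]
  have nA3 : ¬ (n ≤ U ∧ U < 2 * n ∧ 2 * n ≤ V ∧ V < 3 * n) := fun h => hU2 h.2.1
  rw [if_neg nA3, if_neg hU2]
  by_cases hU3 : U < 3 * n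
  · have hxU := hx (U - 2 * n) (by omega)
    rw [if_pos hU3]
    by_cases hVr : 3 * n ≤ V ∧ V < 4 * n
    · have hne : U + n ≠ V := fun e => hxU (Or.inr (Or.inr (Or.inr (Or.inl ⟨by omega, by omega⟩))))
      rw [if_pos ⟨by omega, hU3, hVr.1, hVr.2⟩, if_pos ⟨hVr.1, hVr.2, hne⟩]
    · have nA4 : ¬ (2 * n ≤ U ∧ U < 3 * n ∧ 3 * n ≤ V ∧ V < 4 * n) := fun h => hVr ⟨h.2.2.1, h.2.2.2⟩
      have nF : ¬ (3 * n ≤ V ∧ V < 4 * n ∧ U + n ≠ V) := fun h => hVr ⟨h.1, h.2.1⟩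
      rw [if_neg nA4, if_neg nA5, if_neg nF]
  · have nA4 : ¬ (2 * n ≤ U ∧ U < 3 * n ∧ 3 * n ≤ V ∧ V < 4 * n) := fun h => hU3 h.2.1
    rw [if_neg nA4, if_neg nA5, if_neg hU3]

/-- **After both loops cell `(U, V)` holds `valF W Q U V`**, and the rest of the data is the setup
data. [folklore] -/
theorem heapB_final (H₁ : ℕ → ℕ) {U V : ℕ} (hU : U < 4 * n + 1) (hV : V < 4 * n + 1) :
    heapB W Q H₁ n (pQ n + 1 + (U * (4 * n + 1) + V)) = valF W Q U V := by
  rw [heapB_cell W Q H₁ n hU hV]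
  split_ifs with h
  · rfl
  · have hle := fixIdx_le (n := n) U V
    exact valA_eq_valF_of_fixIdx W Q hU hV (by omega)

/-! ## The program -/

/-- Setup, part 1 (after `relocate`; cell `1` holds `D = n² + 101` and cell `D` holds `n`): `r2 := n`,
`r3 := N = 4 n + 1`, `r20 := n²`, `r4 := 1`. [folklore] -/
def setup1 : List OpSpec :=
  [(.add, .dir 2, .ind 1, .imm 0), (.mul, .dir 3, .dir 2, .imm 4), (.add, .dir 3, .dir 3, .imm 1),
    (.mul, .dir 20, .dir 2, .dir 2), (.add, .dir 4, .imm 1, .imm 0)]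

/-- `c` multiplications `r4 := r4 · n`, computing `M = nᶜ`. [folklore] -/
def powOps (c : ℕ) : List OpSpec := List.replicate c (.mul, .dir 4, .dir 4, .dir 2)

/-- Setup, part 2: `Q = 2M + 2` (`r5`), the codes `2Q + 1` (`r6`), `4Q + 1 = ⌜2Q⌝` (`r7`),
`6Q - 1 = ⌜3Q - 1⌝` (`r8`), the code base `pC n` (`r9`), the query block `pQ n` (`r10`) and its first
cell (`r11`), the query length `N² + 1` (`r15`), the answer address `pR n` (`r16`), the in-row offsets
`n` (`r17`), `n N + 2 n` (`r18`), `2 n N + 3 n` (`r19`), `3 n` (`r21`), `4 n` (`r22`), the header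
`mem[pQ n] := N`, and the counter of loop A `r30 := n²`. [folklore] -/
def setup2 : List OpSpec :=
  [(.mul, .dir 5, .dir 4, .imm 2), (.add, .dir 5, .dir 5, .imm 2),
    (.mul, .dir 6, .dir 5, .imm 2), (.add, .dir 6, .dir 6, .imm 1),
    (.mul, .dir 7, .dir 5, .imm 4), (.add, .dir 7, .dir 7, .imm 1),
    (.mul, .dir 8, .dir 5, .imm 6), (.sub, .dir 8, .dir 8, .imm 1),
    (.add, .dir 9, .dir 1, .imm 2),
    (.add, .dir 10, .dir 1, .dir 20), (.add, .dir 10, .dir 10, .imm 2), (.add, .dir 11, .dir 10, .imm 1),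
    (.mul, .dir 15, .dir 3, .dir 3), (.add, .dir 15, .dir 15, .imm 1), (.add, .dir 16, .dir 10, .dir 15),
    (.add, .dir 17, .dir 2, .imm 0),
    (.mul, .dir 18, .dir 2, .dir 3), (.add, .dir 18, .dir 18, .dir 2), (.add, .dir 18, .dir 18, .dir 2),
    (.mul, .dir 19, .dir 2, .dir 3), (.mul, .dir 19, .dir 19, .imm 2), (.mul, .dir 21, .dir 2, .imm 3),
    (.add, .dir 19, .dir 19, .dir 21), (.mul, .dir 22, .dir 2, .imm 4),
    (.add, .ind 10, .dir 3, .imm 0), (.add, .dir 30, .dir 20, .imm 0)]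

/-- **The body of loop A** (iteration `t = n² - r30 = u n + v`): decode `u, v`, the cell
`d₁ = pQ n + 1 + (u N + v)` of the arc `u_I → v_I`, read the code `⌜W u v⌝` at `pC n + t`, recode it
(`recode`), and write `⌜2Q⌝` at `d₁` and `d₁ + 3 n` (`u_I → v_L`), the recoded weight at `d₁ + n`
(`u_I → v_J`), `d₁ + (n N + 2 n)` (`u_J → v_K`) and `d₁ + (2 n N + 3 n)` (`u_K → v_L`); count down.
[folklore] -/
def bodyA : List OpSpec :=
  [(.sub, .dir 34, .dir 20, .dir 30), (.div, .dir 32, .dir 34, .dir 2), (.mod, .dir 33, .dir 34, .dir 2),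
    (.mul, .dir 35, .dir 32, .dir 3), (.add, .dir 35, .dir 35, .dir 33), (.add, .dir 35, .dir 35, .dir 11),
    (.add, .dir 36, .dir 9, .dir 34), (.add, .dir 37, .ind 36, .imm 0),
    (.sub, .dir 38, .dir 37, .imm 1), (.mod, .dir 39, .dir 38, .imm 2), (.add, .dir 40, .dir 38, .dir 39),
    (.add, .dir 41, .dir 6, .dir 40), (.mul, .dir 42, .dir 39, .dir 40), (.mul, .dir 42, .dir 42, .imm 2),
    (.sub, .dir 41, .dir 41, .dir 42),
    (.add, .ind 35, .dir 7, .imm 0),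
    (.add, .dir 43, .dir 35, .dir 17), (.add, .ind 43, .dir 41, .imm 0),
    (.add, .dir 43, .dir 35, .dir 18), (.add, .ind 43, .dir 41, .imm 0),
    (.add, .dir 43, .dir 35, .dir 19), (.add, .ind 43, .dir 41, .imm 0),
    (.add, .dir 43, .dir 35, .dir 21), (.add, .ind 43, .dir 7, .imm 0),
    (.sub, .dir 30, .dir 30, .imm 1)]

/-- Before loop B: its counter `r30 := n`. [folklore] -/
def preB : List OpSpec := [(.add, .dir 30, .dir 2, .imm 0)]

/-- **The body of loop B** (iteration `u = n - r30`, row start `r = u N + (pQ n + 1)`): write `0 = ⌜⊤⌝`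
at `r + u` (`u_I → u_I`), `r + u + (n N + 2 n)` (`u_J → u_K`), `r + u + (2 n N + 3 n)` (`u_K → u_L`),
`r + u + 3 n` (`u_I → u_L`), `⌜2Q⌝` at `r + u + n` (`u_I → u_J`), and `⌜3Q - 1⌝` at `r + 4 n`
(`u_I → y`); count down. [folklore] -/
def bodyB : List OpSpec :=
  [(.sub, .dir 32, .dir 2, .dir 30), (.mul, .dir 35, .dir 32, .dir 3), (.add, .dir 35, .dir 35, .dir 11),
    (.add, .dir 43, .dir 35, .dir 32), (.add, .ind 43, .imm 0, .imm 0),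
    (.add, .dir 43, .dir 43, .dir 17), (.add, .ind 43, .dir 7, .imm 0),
    (.add, .dir 44, .dir 35, .dir 32),
    (.add, .dir 43, .dir 44, .dir 18), (.add, .ind 43, .imm 0, .imm 0),
    (.add, .dir 43, .dir 44, .dir 19), (.add, .ind 43, .imm 0, .imm 0),
    (.add, .dir 43, .dir 44, .dir 21), (.add, .ind 43, .imm 0, .imm 0),
    (.add, .dir 43, .dir 35, .dir 22), (.add, .ind 43, .dir 8, .imm 0),
    (.sub, .dir 30, .dir 30, .imm 1)]

/-- After the query: `mem[1] := (answer word = 6Q - 1)`, `mem[0] := 1` (output `[1]` or `[0]`).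
[folklore] -/
def finishOps : List OpSpec :=
  [(.add, .dir 45, .dir 16, .imm 1), (.eq, .dir 1, .ind 45, .dir 8), (.add, .dir 0, .imm 1, .imm 0)]

/-- **The reduction program** Negative Triangle `≤₃` Radius for the weight exponent `c` (this
library's word-RAM rendering of Abboud–Grandoni–Vassilevska Williams, SODA 2015, Lemma 2.3, on the
dense gadget): relocate the input, set up the layout, write the gadget (loops A and B), query the
Radius oracle once, and compare the radius code with `⌜3Q - 1⌝`.
[cite: AbboudGrandoniVassilevskaWilliams2015, Lemma 2.3 (proof of Thm. 1.1)] -/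
def prog (c : ℕ) : SProg :=
  seqs [relocate, block setup1, block (powOps c), block setup2, whilenz (.dir 30) (block bodyA),
    block preB, whilenz (.dir 30) (block bodyB), SProg.query (.dir 10) (.dir 15) (.dir 16),
    block finishOps]

/-- The compiled program is deterministic. [folklore] -/
theorem prog_isDeterministic (c : ℕ) : (prog c).toProgram.IsDeterministic :=
  toProgram_isDeterministic _

/-! ## The layout registers -/

/-- **The layout registers** after the setup (see `setup2`). [folklore] -/
structure Regs (n Q : ℕ) (S : ℕ → ℕ) : Prop where
  r2 : S 2 = n
  r3 : S 3 = 4 * n + 1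
  r6 : S 6 = 2 * Q + 1
  r7 : S 7 = 4 * Q + 1
  r8 : S 8 = 6 * Q - 1
  r9 : S 9 = pC n
  r10 : S 10 = pQ n
  r11 : S 11 = pQ n + 1
  r15 : S 15 = (4 * n + 1) * (4 * n + 1) + 1
  r16 : S 16 = pR n
  r17 : S 17 = n
  r18 : S 18 = n * (4 * n + 1) + 2 * n
  r19 : S 19 = n * (4 * n + 1) * 2 + 3 * n
  r20 : S 20 = n * n
  r21 : S 21 = 3 * n
  r22 : S 22 = 4 * n

/-- The layout registers survive any change of the registers outside `2, …, 22`. [folklore] -/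
theorem Regs.of_agree {n Q : ℕ} {S S' : ℕ → ℕ} (h : Regs n Q S)
    (hag : ∀ r, 2 ≤ r → r ≤ 22 → S' r = S r) : Regs n Q S' := by
  obtain ⟨h2, h3, h6, h7, h8, h9, h10, h11, h15, h16, h17, h18, h19, h20, h21, h22⟩ := h
  exact ⟨(hag 2 (by norm_num) (by norm_num)).trans h2, (hag 3 (by norm_num) (by norm_num)).trans h3,
    (hag 6 (by norm_num) (by norm_num)).trans h6, (hag 7 (by norm_num) (by norm_num)).trans h7,
    (hag 8 (by norm_num) (by norm_num)).trans h8, (hag 9 (by norm_num) (by norm_num)).trans h9,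
    (hag 10 (by norm_num) (by norm_num)).trans h10, (hag 11 (by norm_num) (by norm_num)).trans h11,
    (hag 15 (by norm_num) (by norm_num)).trans h15, (hag 16 (by norm_num) (by norm_num)).trans h16,
    (hag 17 (by norm_num) (by norm_num)).trans h17, (hag 18 (by norm_num) (by norm_num)).trans h18,
    (hag 19 (by norm_num) (by norm_num)).trans h19, (hag 20 (by norm_num) (by norm_num)).trans h20,
    (hag 21 (by norm_num) (by norm_num)).trans h21, (hag 22 (by norm_num) (by norm_num)).trans h22⟩

/-! ## Arithmetic of the layout -/

/-- `n N = 4 n² + n`. [folklore] -/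
theorem n_mul_N (n : ℕ) : n * (4 * n + 1) = 4 * (n * n) + n := by ring

/-- `N² = 16 n² + 8 n + 1`. [folklore] -/
theorem N_mul_N (n : ℕ) : (4 * n + 1) * (4 * n + 1) = 16 * (n * n) + 8 * n + 1 := by ring

/-! ## The input and its relocation -/

section semantics

variable {n w : ℕ} {O : List ℕ → List ℕ} (W : Matrix (Fin n) (Fin n) ℤ)

/-- Cell `1` of the relocated memory holds `D = n² + 101`. [folklore] -/
theorem relocated_one' : relocated (inp W) 1 = n * n + 101 := by
  rw [relocated_one, inp_length]

/-- Cell `D` of the relocated memory holds `n`. [folklore] -/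
theorem relocated_D : relocated (inp W) (n * n + 101) = n := by
  have hlen := inp_length W
  have : n * n + 101 = (inp W).length + 100 := by rw [hlen]
  rw [this]
  unfold relocated
  rw [if_neg (by omega), if_neg (by omega), if_pos rfl, List.getD_eq_getElem _ _ (by rw [hlen]; omega),
    inp_getElem_zero]

/-- The relocated input: the code of entry `t` sits at `pC n + t`. [folklore] -/
theorem relocated_code {t : ℕ} (ht : t < n * n) : relocated (inp W) (pC n + t) = code W t := by
  have hlen := inp_length W
  have : pC n + t = (inp W).length + 100 + (t + 2) := by rw [hlen, pC]; ring
  rw [this, relocated_base_add _ (by omega) (by rw [hlen]; omega), show t + 2 - 1 = t + 1 by omega,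
    List.getD_eq_getElem _ _ (by rw [hlen]; omega), inp_getElem_succ W ht]

/-- Above the relocated input (from `pQ n` on) the memory is `0`. [folklore] -/
theorem relocated_high {a : ℕ} (ha : pQ n ≤ a) : relocated (inp W) a = 0 :=
  relocated_of_lt _ (by rw [inp_length]; rw [pQ] at ha; omega)

/-! ## Setup -/

-- The symbolic execution below uses one uniform `simp only` read-normaliser per instruction;
-- not every lemma of the set fires at every instruction.
set_option linter.unusedSimpArgs false in
/-- **Setup, part 1**: `r2 = n`, `r3 = 4 n + 1`, `r20 = n²`, `r4 = 1` (and `r1 = n² + 101` kept); the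
data is the relocated input. [folklore] -/
theorem setup1_spec (hF : pTop n < 2 ^ w) (qs : List (List ℕ)) :
    ∃ S : ℕ → ℕ, Exec w O (block setup1) ⟨merge (relocated (inp W)) (relocated (inp W)), qs⟩
        ⟨merge S (relocated (inp W)), qs⟩ 5 ∧
      S 1 = n * n + 101 ∧ S 2 = n ∧ S 3 = 4 * n + 1 ∧ S 4 = 1 ∧ S 20 = n * n := by
  have hT : pTop n = 18 * (n * n) + 8 * n + 107 := rfl
  have h1 : relocated (inp W) 1 = n * n + 101 := relocated_one' W
  have hDn : relocated (inp W) (n * n + 101) = n := relocated_D W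
  have hnn : n ≤ n * n := Nat.le_mul_self n
  have key : ∀ R, execOps w (merge (relocated (inp W)) (relocated (inp W))) setup1 = R →
      ∃ S : ℕ → ℕ, R = merge S (relocated (inp W)) ∧
        S 1 = n * n + 101 ∧ S 2 = n ∧ S 3 = 4 * n + 1 ∧ S 4 = 1 ∧ S 20 = n * n := by
    intro R hR
    unfold setup1 at hR
    have htmp := execOps_cons_fwd hR; clear hR; obtain ⟨v1, hv1, hR⟩ := htmp
    simp -failIfUnchanged (disch := omega) only [Operand.write, Operand.read, merge_apply_of_lt,
      merge_apply_of_le, Function.update_self, Function.update_of_ne, update_merge_of_lt,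
      update_merge_of_le, Nat.add_zero, Nat.zero_add, BinOp.eval_mod, BinOp.eval_eq, BinOp.eval_band,
      BinOp.eval_shr, BinOp.eval_div, BinOp.eval_lt, BinOp.eval_add_of_lt, BinOp.eval_sub_of_le,
      BinOp.eval_mul_of_lt, h1, hDn] at hv1 hR; subst hv1
    have htmp := execOps_cons_fwd hR; clear hR; obtain ⟨v2, hv2, hR⟩ := htmp
    simp -failIfUnchanged (disch := omega) only [Operand.write, Operand.read, merge_apply_of_lt,
      merge_apply_of_le, Function.update_self, Function.update_of_ne, update_merge_of_lt,
      update_merge_of_le, Nat.add_zero, Nat.zero_add, BinOp.eval_mod, BinOp.eval_eq, BinOp.eval_band,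
      BinOp.eval_shr, BinOp.eval_div, BinOp.eval_lt, BinOp.eval_add_of_lt, BinOp.eval_sub_of_le,
      BinOp.eval_mul_of_lt, h1, hDn] at hv2 hR; subst hv2
    have htmp := execOps_cons_fwd hR; clear hR; obtain ⟨v3, hv3, hR⟩ := htmp
    simp -failIfUnchanged (disch := omega) only [Operand.write, Operand.read, merge_apply_of_lt,
      merge_apply_of_le, Function.update_self, Function.update_of_ne, update_merge_of_lt,
      update_merge_of_le, Nat.add_zero, Nat.zero_add, BinOp.eval_mod, BinOp.eval_eq, BinOp.eval_band,
      BinOp.eval_shr, BinOp.eval_div, BinOp.eval_lt, BinOp.eval_add_of_lt, BinOp.eval_sub_of_le,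
      BinOp.eval_mul_of_lt, h1, hDn] at hv3 hR; subst hv3
    have htmp := execOps_cons_fwd hR; clear hR; obtain ⟨v4, hv4, hR⟩ := htmp
    simp -failIfUnchanged (disch := omega) only [Operand.write, Operand.read, merge_apply_of_lt,
      merge_apply_of_le, Function.update_self, Function.update_of_ne, update_merge_of_lt,
      update_merge_of_le, Nat.add_zero, Nat.zero_add, BinOp.eval_mod, BinOp.eval_eq, BinOp.eval_band,
      BinOp.eval_shr, BinOp.eval_div, BinOp.eval_lt, BinOp.eval_add_of_lt, BinOp.eval_sub_of_le,
      BinOp.eval_mul_of_lt, h1, hDn] at hv4 hR; subst hv4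
    have htmp := execOps_cons_fwd hR; clear hR; obtain ⟨v5, hv5, hR⟩ := htmp
    simp -failIfUnchanged (disch := omega) only [Operand.write, Operand.read, merge_apply_of_lt,
      merge_apply_of_le, Function.update_self, Function.update_of_ne, update_merge_of_lt,
      update_merge_of_le, Nat.add_zero, Nat.zero_add, BinOp.eval_mod, BinOp.eval_eq, BinOp.eval_band,
      BinOp.eval_shr, BinOp.eval_div, BinOp.eval_lt, BinOp.eval_add_of_lt, BinOp.eval_sub_of_le,
      BinOp.eval_mul_of_lt, h1, hDn] at hv5 hR; subst hv5
    simp only [execOps_nil] at hR; subst hR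
    refine ⟨_, rfl, ?_, ?_, ?_, ?_, ?_⟩
    all_goals simp only [Function.update_self, Function.update_of_ne, ne_eq, Nat.reduceEqDiff,
      not_false_eq_true, h1]
    all_goals omega
  obtain ⟨S, hR, h⟩ := key _ rfl
  exact ⟨S, Exec.block' setup1 qs hR, h⟩

/-- **The power block**: `c` multiplications by `n` take register `4` from `1` to `nᶜ`
(no overflow as long as `nᶜ < 2 ^ w`), changing nothing else. [folklore] -/
theorem powOps_exec (c : ℕ) {S : ℕ → ℕ} (H : ℕ → ℕ) (h2 : S 2 = n) (h4w : S 4 < 2 ^ w)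
    (hcw : S 4 * n ^ c < 2 ^ w) :
    execOps w (merge S H) (powOps c) = merge (Function.update S 4 (S 4 * n ^ c)) H := by
  induction c generalizing S with
  | zero => simp only [powOps, List.replicate, execOps_nil, pow_zero, Nat.mul_one, Function.update_eq_self]
  | succ c ih =>
    have hmulw : S 4 * n < 2 ^ w := by
      rcases Nat.eq_zero_or_pos n with h0 | hn
      · rw [h0, Nat.mul_zero]; exact Nat.two_pow_pos w
      · calc S 4 * n ≤ S 4 * n ^ (c + 1) := Nat.mul_le_mul_left _ (by
              calc n = n ^ 1 := (pow_one n).symm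
                _ ≤ n ^ (c + 1) := Nat.pow_le_pow_right hn (by omega))
          _ < 2 ^ w := hcw
    have hstep : execOp w (merge S H) (.mul, .dir 4, .dir 4, .dir 2) =
        merge (Function.update S 4 (S 4 * n)) H := by
      simp only [execOp, Operand.write, Operand.read, merge_apply_of_lt (show 4 < 100 by norm_num),
        merge_apply_of_lt (show 2 < 100 by norm_num), h2, update_merge_of_lt S H (show 4 < 100 by norm_num)]
      rw [BinOp.eval_mul_of_lt hmulw]
    show execOps w (merge S H) ((.mul, .dir 4, .dir 4, .dir 2) :: powOps c) = _
    rw [execOps_cons, hstep, ih (by rw [Function.update_of_ne (by norm_num), h2]) (by rw [Function.update_self]; exact hmulw)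
      (by rw [Function.update_self, Nat.mul_assoc, ← pow_succ']; exact hcw)]
    rw [Function.update_idem, Function.update_self, Nat.mul_assoc, ← pow_succ']

/-- The power block as an execution: `c` steps. [folklore] -/
theorem pow_spec (c : ℕ) {S : ℕ → ℕ} (H : ℕ → ℕ) (h2 : S 2 = n) (h4 : S 4 = 1) (hcw : n ^ c < 2 ^ w)
    (hF : pTop n < 2 ^ w) (qs : List (List ℕ)) :
    Exec w O (block (powOps c)) ⟨merge S H, qs⟩ ⟨merge (Function.update S 4 (n ^ c)) H, qs⟩ c := by
  have hT : pTop n = 18 * (n * n) + 8 * n + 107 := rfl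
  have h := powOps_exec (w := w) c H h2 (by rw [h4]; omega) (by rw [h4, Nat.one_mul]; exact hcw)
  rw [h4, Nat.one_mul] at h
  have hlen : (powOps c).length = c := by simp [powOps]
  have := Exec.block' (w := w) (O := O) (powOps c) qs h
  rw [hlen] at this
  exact this

-- The symbolic execution below uses one uniform `simp only` read-normaliser per instruction;
-- not every lemma of the set fires at every instruction.
set_option linter.unusedSimpArgs false in
/-- **Setup, part 2**: the layout registers, the counter of loop A, and the query header
`mem[pQ n] := N`; the rest of the data is the relocated input. [folklore] -/
theorem setup2_spec {c : ℕ} {S : ℕ → ℕ} (h1 : S 1 = n * n + 101) (h2 : S 2 = n) (h3 : S 3 = 4 * n + 1)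
    (h4 : S 4 = n ^ c) (h20 : S 20 = n * n) (hF : pTop n < 2 ^ w) (hQw : 8 * wQ n c < 2 ^ w)
    (qs : List (List ℕ)) :
    ∃ S' H : ℕ → ℕ, Exec w O (block setup2) ⟨merge S (relocated (inp W)), qs⟩ ⟨merge S' H, qs⟩ 26 ∧
      Regs n (wQ n c) S' ∧ S' 30 = n * n ∧ H (pQ n) = 4 * n + 1 ∧
      ∀ a, a ≠ pQ n → H a = relocated (inp W) a := by
  have hC : pC n = n * n + 103 := rfl
  have hQ : pQ n = 2 * (n * n) + 103 := rfl
  have hRR : pR n = 18 * (n * n) + 8 * n + 105 := rfl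
  have hT : pTop n = 18 * (n * n) + 8 * n + 107 := rfl
  have hnN := n_mul_N n
  have hNN := N_mul_N n
  have hnn : n ≤ n * n := Nat.le_mul_self n
  obtain ⟨Q, hQfold⟩ : ∃ Q, n ^ c * 2 + 2 = Q := ⟨_, rfl⟩
  have hQdef : wQ n c = Q := by rw [← hQfold, wQ]; ring
  rw [hQdef] at hQw ⊢
  have key : ∀ R, execOps w (merge S (relocated (inp W))) setup2 = R →
      ∃ S' H : ℕ → ℕ, R = merge S' H ∧
        Regs n Q S' ∧ S' 30 = n * n ∧ H (pQ n) = 4 * n + 1 ∧ ∀ a, a ≠ pQ n → H a = relocated (inp W) a := by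
    intro R hR
    unfold setup2 at hR
    have htmp := execOps_cons_fwd hR; clear hR; obtain ⟨v1, hv1, hR⟩ := htmp
    simp -failIfUnchanged (disch := omega) only [Operand.write, Operand.read, merge_apply_of_lt,
      merge_apply_of_le, Function.update_self, Function.update_of_ne, update_merge_of_lt,
      update_merge_of_le, Nat.add_zero, Nat.zero_add, BinOp.eval_mod, BinOp.eval_eq, BinOp.eval_band,
      BinOp.eval_shr, BinOp.eval_div, BinOp.eval_lt, BinOp.eval_add_of_lt, BinOp.eval_sub_of_le,
      BinOp.eval_mul_of_lt, h1, h2, h3, h4, h20, hQfold] at hv1 hR; subst hv1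
    have htmp := execOps_cons_fwd hR; clear hR; obtain ⟨v2, hv2, hR⟩ := htmp
    simp -failIfUnchanged (disch := omega) only [Operand.write, Operand.read, merge_apply_of_lt,
      merge_apply_of_le, Function.update_self, Function.update_of_ne, update_merge_of_lt,
      update_merge_of_le, Nat.add_zero, Nat.zero_add, BinOp.eval_mod, BinOp.eval_eq, BinOp.eval_band,
      BinOp.eval_shr, BinOp.eval_div, BinOp.eval_lt, BinOp.eval_add_of_lt, BinOp.eval_sub_of_le,
      BinOp.eval_mul_of_lt, h1, h2, h3, h4, h20, hQfold] at hv2 hR; subst hv2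
    have htmp := execOps_cons_fwd hR; clear hR; obtain ⟨v3, hv3, hR⟩ := htmp
    simp -failIfUnchanged (disch := omega) only [Operand.write, Operand.read, merge_apply_of_lt,
      merge_apply_of_le, Function.update_self, Function.update_of_ne, update_merge_of_lt,
      update_merge_of_le, Nat.add_zero, Nat.zero_add, BinOp.eval_mod, BinOp.eval_eq, BinOp.eval_band,
      BinOp.eval_shr, BinOp.eval_div, BinOp.eval_lt, BinOp.eval_add_of_lt, BinOp.eval_sub_of_le,
      BinOp.eval_mul_of_lt, h1, h2, h3, h4, h20, hQfold] at hv3 hR; subst hv3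
    have htmp := execOps_cons_fwd hR; clear hR; obtain ⟨v4, hv4, hR⟩ := htmp
    simp -failIfUnchanged (disch := omega) only [Operand.write, Operand.read, merge_apply_of_lt,
      merge_apply_of_le, Function.update_self, Function.update_of_ne, update_merge_of_lt,
      update_merge_of_le, Nat.add_zero, Nat.zero_add, BinOp.eval_mod, BinOp.eval_eq, BinOp.eval_band,
      BinOp.eval_shr, BinOp.eval_div, BinOp.eval_lt, BinOp.eval_add_of_lt, BinOp.eval_sub_of_le,
      BinOp.eval_mul_of_lt, h1, h2, h3, h4, h20, hQfold] at hv4 hR; subst hv4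
    have htmp := execOps_cons_fwd hR; clear hR; obtain ⟨v5, hv5, hR⟩ := htmp
    simp -failIfUnchanged (disch := omega) only [Operand.write, Operand.read, merge_apply_of_lt,
      merge_apply_of_le, Function.update_self, Function.update_of_ne, update_merge_of_lt,
      update_merge_of_le, Nat.add_zero, Nat.zero_add, BinOp.eval_mod, BinOp.eval_eq, BinOp.eval_band,
      BinOp.eval_shr, BinOp.eval_div, BinOp.eval_lt, BinOp.eval_add_of_lt, BinOp.eval_sub_of_le,
      BinOp.eval_mul_of_lt, h1, h2, h3, h4, h20, hQfold] at hv5 hR; subst hv5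
    have htmp := execOps_cons_fwd hR; clear hR; obtain ⟨v6, hv6, hR⟩ := htmp
    simp -failIfUnchanged (disch := omega) only [Operand.write, Operand.read, merge_apply_of_lt,
      merge_apply_of_le, Function.update_self, Function.update_of_ne, update_merge_of_lt,
      update_merge_of_le, Nat.add_zero, Nat.zero_add, BinOp.eval_mod, BinOp.eval_eq, BinOp.eval_band,
      BinOp.eval_shr, BinOp.eval_div, BinOp.eval_lt, BinOp.eval_add_of_lt, BinOp.eval_sub_of_le,
      BinOp.eval_mul_of_lt, h1, h2, h3, h4, h20, hQfold] at hv6 hR; subst hv6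
    have htmp := execOps_cons_fwd hR; clear hR; obtain ⟨v7, hv7, hR⟩ := htmp
    simp -failIfUnchanged (disch := omega) only [Operand.write, Operand.read, merge_apply_of_lt,
      merge_apply_of_le, Function.update_self, Function.update_of_ne, update_merge_of_lt,
      update_merge_of_le, Nat.add_zero, Nat.zero_add, BinOp.eval_mod, BinOp.eval_eq, BinOp.eval_band,
      BinOp.eval_shr, BinOp.eval_div, BinOp.eval_lt, BinOp.eval_add_of_lt, BinOp.eval_sub_of_le,
      BinOp.eval_mul_of_lt, h1, h2, h3, h4, h20, hQfold] at hv7 hR; subst hv7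
    have htmp := execOps_cons_fwd hR; clear hR; obtain ⟨v8, hv8, hR⟩ := htmp
    simp -failIfUnchanged (disch := omega) only [Operand.write, Operand.read, merge_apply_of_lt,
      merge_apply_of_le, Function.update_self, Function.update_of_ne, update_merge_of_lt,
      update_merge_of_le, Nat.add_zero, Nat.zero_add, BinOp.eval_mod, BinOp.eval_eq, BinOp.eval_band,
      BinOp.eval_shr, BinOp.eval_div, BinOp.eval_lt, BinOp.eval_add_of_lt, BinOp.eval_sub_of_le,
      BinOp.eval_mul_of_lt, h1, h2, h3, h4, h20, hQfold] at hv8 hR; subst hv8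
    have htmp := execOps_cons_fwd hR; clear hR; obtain ⟨v9, hv9, hR⟩ := htmp
    simp -failIfUnchanged (disch := omega) only [Operand.write, Operand.read, merge_apply_of_lt,
      merge_apply_of_le, Function.update_self, Function.update_of_ne, update_merge_of_lt,
      update_merge_of_le, Nat.add_zero, Nat.zero_add, BinOp.eval_mod, BinOp.eval_eq, BinOp.eval_band,
      BinOp.eval_shr, BinOp.eval_div, BinOp.eval_lt, BinOp.eval_add_of_lt, BinOp.eval_sub_of_le,
      BinOp.eval_mul_of_lt, h1, h2, h3, h4, h20, hQfold] at hv9 hR; subst hv9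
    have htmp := execOps_cons_fwd hR; clear hR; obtain ⟨v10, hv10, hR⟩ := htmp
    simp -failIfUnchanged (disch := omega) only [Operand.write, Operand.read, merge_apply_of_lt,
      merge_apply_of_le, Function.update_self, Function.update_of_ne, update_merge_of_lt,
      update_merge_of_le, Nat.add_zero, Nat.zero_add, BinOp.eval_mod, BinOp.eval_eq, BinOp.eval_band,
      BinOp.eval_shr, BinOp.eval_div, BinOp.eval_lt, BinOp.eval_add_of_lt, BinOp.eval_sub_of_le,
      BinOp.eval_mul_of_lt, h1, h2, h3, h4, h20, hQfold] at hv10 hR; subst hv10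
    have htmp := execOps_cons_fwd hR; clear hR; obtain ⟨v11, hv11, hR⟩ := htmp
    simp -failIfUnchanged (disch := omega) only [Operand.write, Operand.read, merge_apply_of_lt,
      merge_apply_of_le, Function.update_self, Function.update_of_ne, update_merge_of_lt,
      update_merge_of_le, Nat.add_zero, Nat.zero_add, BinOp.eval_mod, BinOp.eval_eq, BinOp.eval_band,
      BinOp.eval_shr, BinOp.eval_div, BinOp.eval_lt, BinOp.eval_add_of_lt, BinOp.eval_sub_of_le,
      BinOp.eval_mul_of_lt, h1, h2, h3, h4, h20, hQfold] at hv11 hR; subst hv11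
    have htmp := execOps_cons_fwd hR; clear hR; obtain ⟨v12, hv12, hR⟩ := htmp
    simp -failIfUnchanged (disch := omega) only [Operand.write, Operand.read, merge_apply_of_lt,
      merge_apply_of_le, Function.update_self, Function.update_of_ne, update_merge_of_lt,
      update_merge_of_le, Nat.add_zero, Nat.zero_add, BinOp.eval_mod, BinOp.eval_eq, BinOp.eval_band,
      BinOp.eval_shr, BinOp.eval_div, BinOp.eval_lt, BinOp.eval_add_of_lt, BinOp.eval_sub_of_le,
      BinOp.eval_mul_of_lt, h1, h2, h3, h4, h20, hQfold] at hv12 hR; subst hv12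
    have htmp := execOps_cons_fwd hR; clear hR; obtain ⟨v13, hv13, hR⟩ := htmp
    simp -failIfUnchanged (disch := omega) only [Operand.write, Operand.read, merge_apply_of_lt,
      merge_apply_of_le, Function.update_self, Function.update_of_ne, update_merge_of_lt,
      update_merge_of_le, Nat.add_zero, Nat.zero_add, BinOp.eval_mod, BinOp.eval_eq, BinOp.eval_band,
      BinOp.eval_shr, BinOp.eval_div, BinOp.eval_lt, BinOp.eval_add_of_lt, BinOp.eval_sub_of_le,
      BinOp.eval_mul_of_lt, h1, h2, h3, h4, h20, hQfold] at hv13 hR; subst hv13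
    have htmp := execOps_cons_fwd hR; clear hR; obtain ⟨v14, hv14, hR⟩ := htmp
    simp -failIfUnchanged (disch := omega) only [Operand.write, Operand.read, merge_apply_of_lt,
      merge_apply_of_le, Function.update_self, Function.update_of_ne, update_merge_of_lt,
      update_merge_of_le, Nat.add_zero, Nat.zero_add, BinOp.eval_mod, BinOp.eval_eq, BinOp.eval_band,
      BinOp.eval_shr, BinOp.eval_div, BinOp.eval_lt, BinOp.eval_add_of_lt, BinOp.eval_sub_of_le,
      BinOp.eval_mul_of_lt, h1, h2, h3, h4, h20, hQfold] at hv14 hR; subst hv14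
    have htmp := execOps_cons_fwd hR; clear hR; obtain ⟨v15, hv15, hR⟩ := htmp
    simp -failIfUnchanged (disch := omega) only [Operand.write, Operand.read, merge_apply_of_lt,
      merge_apply_of_le, Function.update_self, Function.update_of_ne, update_merge_of_lt,
      update_merge_of_le, Nat.add_zero, Nat.zero_add, BinOp.eval_mod, BinOp.eval_eq, BinOp.eval_band,
      BinOp.eval_shr, BinOp.eval_div, BinOp.eval_lt, BinOp.eval_add_of_lt, BinOp.eval_sub_of_le,
      BinOp.eval_mul_of_lt, h1, h2, h3, h4, h20, hQfold] at hv15 hR; subst hv15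
    have htmp := execOps_cons_fwd hR; clear hR; obtain ⟨v16, hv16, hR⟩ := htmp
    simp -failIfUnchanged (disch := omega) only [Operand.write, Operand.read, merge_apply_of_lt,
      merge_apply_of_le, Function.update_self, Function.update_of_ne, update_merge_of_lt,
      update_merge_of_le, Nat.add_zero, Nat.zero_add, BinOp.eval_mod, BinOp.eval_eq, BinOp.eval_band,
      BinOp.eval_shr, BinOp.eval_div, BinOp.eval_lt, BinOp.eval_add_of_lt, BinOp.eval_sub_of_le,
      BinOp.eval_mul_of_lt, h1, h2, h3, h4, h20, hQfold] at hv16 hR; subst hv16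
    have htmp := execOps_cons_fwd hR; clear hR; obtain ⟨v17, hv17, hR⟩ := htmp
    simp -failIfUnchanged (disch := omega) only [Operand.write, Operand.read, merge_apply_of_lt,
      merge_apply_of_le, Function.update_self, Function.update_of_ne, update_merge_of_lt,
      update_merge_of_le, Nat.add_zero, Nat.zero_add, BinOp.eval_mod, BinOp.eval_eq, BinOp.eval_band,
      BinOp.eval_shr, BinOp.eval_div, BinOp.eval_lt, BinOp.eval_add_of_lt, BinOp.eval_sub_of_le,
      BinOp.eval_mul_of_lt, h1, h2, h3, h4, h20, hQfold] at hv17 hR; subst hv17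
    have htmp := execOps_cons_fwd hR; clear hR; obtain ⟨v18, hv18, hR⟩ := htmp
    simp -failIfUnchanged (disch := omega) only [Operand.write, Operand.read, merge_apply_of_lt,
      merge_apply_of_le, Function.update_self, Function.update_of_ne, update_merge_of_lt,
      update_merge_of_le, Nat.add_zero, Nat.zero_add, BinOp.eval_mod, BinOp.eval_eq, BinOp.eval_band,
      BinOp.eval_shr, BinOp.eval_div, BinOp.eval_lt, BinOp.eval_add_of_lt, BinOp.eval_sub_of_le,
      BinOp.eval_mul_of_lt, h1, h2, h3, h4, h20, hQfold] at hv18 hR; subst hv18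
    have htmp := execOps_cons_fwd hR; clear hR; obtain ⟨v19, hv19, hR⟩ := htmp
    simp -failIfUnchanged (disch := omega) only [Operand.write, Operand.read, merge_apply_of_lt,
      merge_apply_of_le, Function.update_self, Function.update_of_ne, update_merge_of_lt,
      update_merge_of_le, Nat.add_zero, Nat.zero_add, BinOp.eval_mod, BinOp.eval_eq, BinOp.eval_band,
      BinOp.eval_shr, BinOp.eval_div, BinOp.eval_lt, BinOp.eval_add_of_lt, BinOp.eval_sub_of_le,
      BinOp.eval_mul_of_lt, h1, h2, h3, h4, h20, hQfold] at hv19 hR; subst hv19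
    have htmp := execOps_cons_fwd hR; clear hR; obtain ⟨v20, hv20, hR⟩ := htmp
    simp -failIfUnchanged (disch := omega) only [Operand.write, Operand.read, merge_apply_of_lt,
      merge_apply_of_le, Function.update_self, Function.update_of_ne, update_merge_of_lt,
      update_merge_of_le, Nat.add_zero, Nat.zero_add, BinOp.eval_mod, BinOp.eval_eq, BinOp.eval_band,
      BinOp.eval_shr, BinOp.eval_div, BinOp.eval_lt, BinOp.eval_add_of_lt, BinOp.eval_sub_of_le,
      BinOp.eval_mul_of_lt, h1, h2, h3, h4, h20, hQfold] at hv20 hR; subst hv20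
    have htmp := execOps_cons_fwd hR; clear hR; obtain ⟨v21, hv21, hR⟩ := htmp
    simp -failIfUnchanged (disch := omega) only [Operand.write, Operand.read, merge_apply_of_lt,
      merge_apply_of_le, Function.update_self, Function.update_of_ne, update_merge_of_lt,
      update_merge_of_le, Nat.add_zero, Nat.zero_add, BinOp.eval_mod, BinOp.eval_eq, BinOp.eval_band,
      BinOp.eval_shr, BinOp.eval_div, BinOp.eval_lt, BinOp.eval_add_of_lt, BinOp.eval_sub_of_le,
      BinOp.eval_mul_of_lt, h1, h2, h3, h4, h20, hQfold] at hv21 hR; subst hv21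
    have htmp := execOps_cons_fwd hR; clear hR; obtain ⟨v22, hv22, hR⟩ := htmp
    simp -failIfUnchanged (disch := omega) only [Operand.write, Operand.read, merge_apply_of_lt,
      merge_apply_of_le, Function.update_self, Function.update_of_ne, update_merge_of_lt,
      update_merge_of_le, Nat.add_zero, Nat.zero_add, BinOp.eval_mod, BinOp.eval_eq, BinOp.eval_band,
      BinOp.eval_shr, BinOp.eval_div, BinOp.eval_lt, BinOp.eval_add_of_lt, BinOp.eval_sub_of_le,
      BinOp.eval_mul_of_lt, h1, h2, h3, h4, h20, hQfold] at hv22 hR; subst hv22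
    have htmp := execOps_cons_fwd hR; clear hR; obtain ⟨v23, hv23, hR⟩ := htmp
    simp -failIfUnchanged (disch := omega) only [Operand.write, Operand.read, merge_apply_of_lt,
      merge_apply_of_le, Function.update_self, Function.update_of_ne, update_merge_of_lt,
      update_merge_of_le, Nat.add_zero, Nat.zero_add, BinOp.eval_mod, BinOp.eval_eq, BinOp.eval_band,
      BinOp.eval_shr, BinOp.eval_div, BinOp.eval_lt, BinOp.eval_add_of_lt, BinOp.eval_sub_of_le,
      BinOp.eval_mul_of_lt, h1, h2, h3, h4, h20, hQfold] at hv23 hR; subst hv23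
    have htmp := execOps_cons_fwd hR; clear hR; obtain ⟨v24, hv24, hR⟩ := htmp
    simp -failIfUnchanged (disch := omega) only [Operand.write, Operand.read, merge_apply_of_lt,
      merge_apply_of_le, Function.update_self, Function.update_of_ne, update_merge_of_lt,
      update_merge_of_le, Nat.add_zero, Nat.zero_add, BinOp.eval_mod, BinOp.eval_eq, BinOp.eval_band,
      BinOp.eval_shr, BinOp.eval_div, BinOp.eval_lt, BinOp.eval_add_of_lt, BinOp.eval_sub_of_le,
      BinOp.eval_mul_of_lt, h1, h2, h3, h4, h20, hQfold] at hv24 hR; subst hv24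
    have htmp := execOps_cons_fwd hR; clear hR; obtain ⟨v25, hv25, hR⟩ := htmp
    simp -failIfUnchanged (disch := omega) only [Operand.write, Operand.read, merge_apply_of_lt,
      merge_apply_of_le, Function.update_self, Function.update_of_ne, update_merge_of_lt,
      update_merge_of_le, Nat.add_zero, Nat.zero_add, BinOp.eval_mod, BinOp.eval_eq, BinOp.eval_band,
      BinOp.eval_shr, BinOp.eval_div, BinOp.eval_lt, BinOp.eval_add_of_lt, BinOp.eval_sub_of_le,
      BinOp.eval_mul_of_lt, h1, h2, h3, h4, h20, hQfold] at hv25 hR; subst hv25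
    have htmp := execOps_cons_fwd hR; clear hR; obtain ⟨v26, hv26, hR⟩ := htmp
    simp -failIfUnchanged (disch := omega) only [Operand.write, Operand.read, merge_apply_of_lt,
      merge_apply_of_le, Function.update_self, Function.update_of_ne, update_merge_of_lt,
      update_merge_of_le, Nat.add_zero, Nat.zero_add, BinOp.eval_mod, BinOp.eval_eq, BinOp.eval_band,
      BinOp.eval_shr, BinOp.eval_div, BinOp.eval_lt, BinOp.eval_add_of_lt, BinOp.eval_sub_of_le,
      BinOp.eval_mul_of_lt, h1, h2, h3, h4, h20, hQfold] at hv26 hR; subst hv26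
    simp only [execOps_nil] at hR; subst hR
    refine ⟨_, _, rfl, ⟨?_, ?_, ?_, ?_, ?_, ?_, ?_, ?_, ?_, ?_, ?_, ?_, ?_, ?_, ?_, ?_⟩, ?_, ?_, ?_⟩
    rotate_right 2
    · simp only [Function.update_apply]; split_ifs <;> first | rfl | omega
    · intro a ha
      simp only [Function.update_apply]; split_ifs <;> first | rfl | omega
    all_goals simp only [Function.update_self, Function.update_of_ne, ne_eq, Nat.reduceEqDiff,
      not_false_eq_true, h1, h2, h3, h4, h20]
    all_goals omega
  obtain ⟨S', H, hR, h⟩ := key _ rfl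
  exact ⟨S', H, Exec.block' setup2 qs hR, h⟩

/-! ## Loop A -/

-- The symbolic execution below uses one uniform `simp only` read-normaliser per instruction;
-- not every lemma of the set fires at every instruction.
set_option linter.unusedSimpArgs false in
/-- **One iteration of loop A** (`t < n²`, counter `r30 = n² - t`): `bodyA` takes the data from
`heapA t` to `heapA (t + 1)` in `25` steps, keeping the layout registers and counting down.
[folklore] -/
theorem bodyA_spec {Q : ℕ} {S H₁ : ℕ → ℕ} (hRg : Regs n Q S) {t : ℕ} (ht : t < n * n)
    (h30 : S 30 = n * n - t) (hH₁ : ∀ t', t' < n * n → H₁ (pC n + t') = code W t')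
    (hcode : ∀ t', code W t' ≤ 2 * Q) (hQ2 : 2 ≤ Q) (hF : pTop n < 2 ^ w) (hQw : 8 * Q < 2 ^ w)
    (qs : List (List ℕ)) :
    ∃ S', Exec w O (block bodyA) ⟨merge S (heapA W Q H₁ t), qs⟩ ⟨merge S' (heapA W Q H₁ (t + 1)), qs⟩ 25 ∧
      Regs n Q S' ∧ S' 30 = n * n - (t + 1) := by
  have hC : pC n = n * n + 103 := rfl
  have hQ' : pQ n = 2 * (n * n) + 103 := rfl
  have hT : pTop n = 18 * (n * n) + 8 * n + 107 := rfl
  have hnN := n_mul_N n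
  have hNN := N_mul_N n
  obtain ⟨h2, h3, h6, h7, h8, h9, h10, h11, h15, h16, h17, h18, h19, h20, h21, h22⟩ := hRg
  -- the iteration's coordinates `t = u n + v`
  have hn : 0 < n := Nat.pos_of_ne_zero fun h0 => by subst h0; simp at ht
  obtain ⟨u, htu⟩ : ∃ u, t / n = u := ⟨_, rfl⟩
  obtain ⟨v, htv⟩ : ∃ v, t % n = v := ⟨_, rfl⟩
  have htuv : t = u * n + v := by rw [← htu, ← htv]; exact (Nat.div_add_mod' t n).symm
  have hv : v < n := by rw [← htv]; exact Nat.mod_lt _ hn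
  have hu : u < n := by rw [← htu]; exact Nat.div_lt_of_lt_mul ht
  have huN : u * (4 * n + 1) + (4 * n + 1) ≤ n * (4 * n + 1) := by
    have := Nat.mul_le_mul_right (4 * n + 1) (Nat.succ_le_of_lt hu); rwa [Nat.succ_mul] at this
  have ht1 : n * n - (n * n - t) = t := by omega
  -- the code read and its recoding
  have hct := hcode t
  have hc1 : 1 ≤ code W t := code_pos W ht
  obtain ⟨p, hp⟩ : ∃ p, (code W t - 1) % 2 = p := ⟨_, rfl⟩
  have hp1 : p ≤ 1 := by omega
  obtain ⟨tt, htt⟩ : ∃ tt, code W t - 1 + p = tt := ⟨_, rfl⟩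
  have httle : tt ≤ 2 * Q := by omega
  have hptt : p * tt ≤ tt := by
    rcases Nat.le_one_iff_eq_zero_or_eq_one.1 hp1 with rfl | rfl <;> simp
  obtain ⟨cv, hcv⟩ : ∃ cv, 2 * Q + 1 + tt - p * tt * 2 = cv := ⟨_, rfl⟩
  have hcvr : recode Q (code W t) = cv := by unfold recode; rw [hp, htt, hcv]
  have hsrc : heapA W Q H₁ t (pC n + t) = code W t := by
    rw [heapA_of_not W Q H₁ t (fun h => by unfold IsCell at h; omega), hH₁ t ht]
  have key : ∀ R, execOps w (merge S (heapA W Q H₁ t)) bodyA = R →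
      ∃ S', R = merge S' (heapA W Q H₁ (t + 1)) ∧ Regs n Q S' ∧ S' 30 = n * n - (t + 1) := by
    intro R hR
    unfold bodyA at hR
    have htmp := execOps_cons_fwd hR; clear hR; obtain ⟨v1, hv1, hR⟩ := htmp
    simp -failIfUnchanged (disch := omega) only [Operand.write, Operand.read, merge_apply_of_lt,
      merge_apply_of_le, Function.update_self, Function.update_of_ne, update_merge_of_lt,
      update_merge_of_le, Nat.add_zero, Nat.zero_add, BinOp.eval_mod, BinOp.eval_eq, BinOp.eval_band,
      BinOp.eval_shr, BinOp.eval_div, BinOp.eval_lt, BinOp.eval_add_of_lt, BinOp.eval_sub_of_le,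
      BinOp.eval_mul_of_lt, h2, h3, h6, h7, h9, h11, h17, h18, h19, h20, h21, h30, ht1, htu, htv, hsrc, hp, htt, hcv] at hv1 hR; subst hv1
    have htmp := execOps_cons_fwd hR; clear hR; obtain ⟨v2, hv2, hR⟩ := htmp
    simp -failIfUnchanged (disch := omega) only [Operand.write, Operand.read, merge_apply_of_lt,
      merge_apply_of_le, Function.update_self, Function.update_of_ne, update_merge_of_lt,
      update_merge_of_le, Nat.add_zero, Nat.zero_add, BinOp.eval_mod, BinOp.eval_eq, BinOp.eval_band,
      BinOp.eval_shr, BinOp.eval_div, BinOp.eval_lt, BinOp.eval_add_of_lt, BinOp.eval_sub_of_le,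
      BinOp.eval_mul_of_lt, h2, h3, h6, h7, h9, h11, h17, h18, h19, h20, h21, h30, ht1, htu, htv, hsrc, hp, htt, hcv] at hv2 hR; subst hv2
    have htmp := execOps_cons_fwd hR; clear hR; obtain ⟨v3, hv3, hR⟩ := htmp
    simp -failIfUnchanged (disch := omega) only [Operand.write, Operand.read, merge_apply_of_lt,
      merge_apply_of_le, Function.update_self, Function.update_of_ne, update_merge_of_lt,
      update_merge_of_le, Nat.add_zero, Nat.zero_add, BinOp.eval_mod, BinOp.eval_eq, BinOp.eval_band,
      BinOp.eval_shr, BinOp.eval_div, BinOp.eval_lt, BinOp.eval_add_of_lt, BinOp.eval_sub_of_le,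
      BinOp.eval_mul_of_lt, h2, h3, h6, h7, h9, h11, h17, h18, h19, h20, h21, h30, ht1, htu, htv, hsrc, hp, htt, hcv] at hv3 hR; subst hv3
    have htmp := execOps_cons_fwd hR; clear hR; obtain ⟨v4, hv4, hR⟩ := htmp
    simp -failIfUnchanged (disch := omega) only [Operand.write, Operand.read, merge_apply_of_lt,
      merge_apply_of_le, Function.update_self, Function.update_of_ne, update_merge_of_lt,
      update_merge_of_le, Nat.add_zero, Nat.zero_add, BinOp.eval_mod, BinOp.eval_eq, BinOp.eval_band,
      BinOp.eval_shr, BinOp.eval_div, BinOp.eval_lt, BinOp.eval_add_of_lt, BinOp.eval_sub_of_le,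
      BinOp.eval_mul_of_lt, h2, h3, h6, h7, h9, h11, h17, h18, h19, h20, h21, h30, ht1, htu, htv, hsrc, hp, htt, hcv] at hv4 hR; subst hv4
    have htmp := execOps_cons_fwd hR; clear hR; obtain ⟨v5, hv5, hR⟩ := htmp
    simp -failIfUnchanged (disch := omega) only [Operand.write, Operand.read, merge_apply_of_lt,
      merge_apply_of_le, Function.update_self, Function.update_of_ne, update_merge_of_lt,
      update_merge_of_le, Nat.add_zero, Nat.zero_add, BinOp.eval_mod, BinOp.eval_eq, BinOp.eval_band,
      BinOp.eval_shr, BinOp.eval_div, BinOp.eval_lt, BinOp.eval_add_of_lt, BinOp.eval_sub_of_le,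
      BinOp.eval_mul_of_lt, h2, h3, h6, h7, h9, h11, h17, h18, h19, h20, h21, h30, ht1, htu, htv, hsrc, hp, htt, hcv] at hv5 hR; subst hv5
    have htmp := execOps_cons_fwd hR; clear hR; obtain ⟨v6, hv6, hR⟩ := htmp
    simp -failIfUnchanged (disch := omega) only [Operand.write, Operand.read, merge_apply_of_lt,
      merge_apply_of_le, Function.update_self, Function.update_of_ne, update_merge_of_lt,
      update_merge_of_le, Nat.add_zero, Nat.zero_add, BinOp.eval_mod, BinOp.eval_eq, BinOp.eval_band,
      BinOp.eval_shr, BinOp.eval_div, BinOp.eval_lt, BinOp.eval_add_of_lt, BinOp.eval_sub_of_le,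
      BinOp.eval_mul_of_lt, h2, h3, h6, h7, h9, h11, h17, h18, h19, h20, h21, h30, ht1, htu, htv, hsrc, hp, htt, hcv] at hv6 hR; subst hv6
    have htmp := execOps_cons_fwd hR; clear hR; obtain ⟨v7, hv7, hR⟩ := htmp
    simp -failIfUnchanged (disch := omega) only [Operand.write, Operand.read, merge_apply_of_lt,
      merge_apply_of_le, Function.update_self, Function.update_of_ne, update_merge_of_lt,
      update_merge_of_le, Nat.add_zero, Nat.zero_add, BinOp.eval_mod, BinOp.eval_eq, BinOp.eval_band,
      BinOp.eval_shr, BinOp.eval_div, BinOp.eval_lt, BinOp.eval_add_of_lt, BinOp.eval_sub_of_le,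
      BinOp.eval_mul_of_lt, h2, h3, h6, h7, h9, h11, h17, h18, h19, h20, h21, h30, ht1, htu, htv, hsrc, hp, htt, hcv] at hv7 hR; subst hv7
    have htmp := execOps_cons_fwd hR; clear hR; obtain ⟨v8, hv8, hR⟩ := htmp
    simp -failIfUnchanged (disch := omega) only [Operand.write, Operand.read, merge_apply_of_lt,
      merge_apply_of_le, Function.update_self, Function.update_of_ne, update_merge_of_lt,
      update_merge_of_le, Nat.add_zero, Nat.zero_add, BinOp.eval_mod, BinOp.eval_eq, BinOp.eval_band,
      BinOp.eval_shr, BinOp.eval_div, BinOp.eval_lt, BinOp.eval_add_of_lt, BinOp.eval_sub_of_le,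
      BinOp.eval_mul_of_lt, h2, h3, h6, h7, h9, h11, h17, h18, h19, h20, h21, h30, ht1, htu, htv, hsrc, hp, htt, hcv] at hv8 hR; subst hv8
    have htmp := execOps_cons_fwd hR; clear hR; obtain ⟨v9, hv9, hR⟩ := htmp
    simp -failIfUnchanged (disch := omega) only [Operand.write, Operand.read, merge_apply_of_lt,
      merge_apply_of_le, Function.update_self, Function.update_of_ne, update_merge_of_lt,
      update_merge_of_le, Nat.add_zero, Nat.zero_add, BinOp.eval_mod, BinOp.eval_eq, BinOp.eval_band,
      BinOp.eval_shr, BinOp.eval_div, BinOp.eval_lt, BinOp.eval_add_of_lt, BinOp.eval_sub_of_le,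
      BinOp.eval_mul_of_lt, h2, h3, h6, h7, h9, h11, h17, h18, h19, h20, h21, h30, ht1, htu, htv, hsrc, hp, htt, hcv] at hv9 hR; subst hv9
    have htmp := execOps_cons_fwd hR; clear hR; obtain ⟨v10, hv10, hR⟩ := htmp
    simp -failIfUnchanged (disch := omega) only [Operand.write, Operand.read, merge_apply_of_lt,
      merge_apply_of_le, Function.update_self, Function.update_of_ne, update_merge_of_lt,
      update_merge_of_le, Nat.add_zero, Nat.zero_add, BinOp.eval_mod, BinOp.eval_eq, BinOp.eval_band,
      BinOp.eval_shr, BinOp.eval_div, BinOp.eval_lt, BinOp.eval_add_of_lt, BinOp.eval_sub_of_le,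
      BinOp.eval_mul_of_lt, h2, h3, h6, h7, h9, h11, h17, h18, h19, h20, h21, h30, ht1, htu, htv, hsrc, hp, htt, hcv] at hv10 hR; subst hv10
    have htmp := execOps_cons_fwd hR; clear hR; obtain ⟨v11, hv11, hR⟩ := htmp
    simp -failIfUnchanged (disch := omega) only [Operand.write, Operand.read, merge_apply_of_lt,
      merge_apply_of_le, Function.update_self, Function.update_of_ne, update_merge_of_lt,
      update_merge_of_le, Nat.add_zero, Nat.zero_add, BinOp.eval_mod, BinOp.eval_eq, BinOp.eval_band,
      BinOp.eval_shr, BinOp.eval_div, BinOp.eval_lt, BinOp.eval_add_of_lt, BinOp.eval_sub_of_le,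
      BinOp.eval_mul_of_lt, h2, h3, h6, h7, h9, h11, h17, h18, h19, h20, h21, h30, ht1, htu, htv, hsrc, hp, htt, hcv] at hv11 hR; subst hv11
    have htmp := execOps_cons_fwd hR; clear hR; obtain ⟨v12, hv12, hR⟩ := htmp
    simp -failIfUnchanged (disch := omega) only [Operand.write, Operand.read, merge_apply_of_lt,
      merge_apply_of_le, Function.update_self, Function.update_of_ne, update_merge_of_lt,
      update_merge_of_le, Nat.add_zero, Nat.zero_add, BinOp.eval_mod, BinOp.eval_eq, BinOp.eval_band,
      BinOp.eval_shr, BinOp.eval_div, BinOp.eval_lt, BinOp.eval_add_of_lt, BinOp.eval_sub_of_le,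
      BinOp.eval_mul_of_lt, h2, h3, h6, h7, h9, h11, h17, h18, h19, h20, h21, h30, ht1, htu, htv, hsrc, hp, htt, hcv] at hv12 hR; subst hv12
    have htmp := execOps_cons_fwd hR; clear hR; obtain ⟨v13, hv13, hR⟩ := htmp
    simp -failIfUnchanged (disch := omega) only [Operand.write, Operand.read, merge_apply_of_lt,
      merge_apply_of_le, Function.update_self, Function.update_of_ne, update_merge_of_lt,
      update_merge_of_le, Nat.add_zero, Nat.zero_add, BinOp.eval_mod, BinOp.eval_eq, BinOp.eval_band,
      BinOp.eval_shr, BinOp.eval_div, BinOp.eval_lt, BinOp.eval_add_of_lt, BinOp.eval_sub_of_le,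
      BinOp.eval_mul_of_lt, h2, h3, h6, h7, h9, h11, h17, h18, h19, h20, h21, h30, ht1, htu, htv, hsrc, hp, htt, hcv] at hv13 hR; subst hv13
    have htmp := execOps_cons_fwd hR; clear hR; obtain ⟨v14, hv14, hR⟩ := htmp
    simp -failIfUnchanged (disch := omega) only [Operand.write, Operand.read, merge_apply_of_lt,
      merge_apply_of_le, Function.update_self, Function.update_of_ne, update_merge_of_lt,
      update_merge_of_le, Nat.add_zero, Nat.zero_add, BinOp.eval_mod, BinOp.eval_eq, BinOp.eval_band,
      BinOp.eval_shr, BinOp.eval_div, BinOp.eval_lt, BinOp.eval_add_of_lt, BinOp.eval_sub_of_le,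
      BinOp.eval_mul_of_lt, h2, h3, h6, h7, h9, h11, h17, h18, h19, h20, h21, h30, ht1, htu, htv, hsrc, hp, htt, hcv] at hv14 hR; subst hv14
    have htmp := execOps_cons_fwd hR; clear hR; obtain ⟨v15, hv15, hR⟩ := htmp
    simp -failIfUnchanged (disch := omega) only [Operand.write, Operand.read, merge_apply_of_lt,
      merge_apply_of_le, Function.update_self, Function.update_of_ne, update_merge_of_lt,
      update_merge_of_le, Nat.add_zero, Nat.zero_add, BinOp.eval_mod, BinOp.eval_eq, BinOp.eval_band,
      BinOp.eval_shr, BinOp.eval_div, BinOp.eval_lt, BinOp.eval_add_of_lt, BinOp.eval_sub_of_le,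
      BinOp.eval_mul_of_lt, h2, h3, h6, h7, h9, h11, h17, h18, h19, h20, h21, h30, ht1, htu, htv, hsrc, hp, htt, hcv] at hv15 hR; subst hv15
    have htmp := execOps_cons_fwd hR; clear hR; obtain ⟨v16, hv16, hR⟩ := htmp
    simp -failIfUnchanged (disch := omega) only [Operand.write, Operand.read, merge_apply_of_lt,
      merge_apply_of_le, Function.update_self, Function.update_of_ne, update_merge_of_lt,
      update_merge_of_le, Nat.add_zero, Nat.zero_add, BinOp.eval_mod, BinOp.eval_eq, BinOp.eval_band,
      BinOp.eval_shr, BinOp.eval_div, BinOp.eval_lt, BinOp.eval_add_of_lt, BinOp.eval_sub_of_le,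
      BinOp.eval_mul_of_lt, h2, h3, h6, h7, h9, h11, h17, h18, h19, h20, h21, h30, ht1, htu, htv, hsrc, hp, htt, hcv] at hv16 hR; subst hv16
    have htmp := execOps_cons_fwd hR; clear hR; obtain ⟨v17, hv17, hR⟩ := htmp
    simp -failIfUnchanged (disch := omega) only [Operand.write, Operand.read, merge_apply_of_lt,
      merge_apply_of_le, Function.update_self, Function.update_of_ne, update_merge_of_lt,
      update_merge_of_le, Nat.add_zero, Nat.zero_add, BinOp.eval_mod, BinOp.eval_eq, BinOp.eval_band,
      BinOp.eval_shr, BinOp.eval_div, BinOp.eval_lt, BinOp.eval_add_of_lt, BinOp.eval_sub_of_le,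
      BinOp.eval_mul_of_lt, h2, h3, h6, h7, h9, h11, h17, h18, h19, h20, h21, h30, ht1, htu, htv, hsrc, hp, htt, hcv] at hv17 hR; subst hv17
    have htmp := execOps_cons_fwd hR; clear hR; obtain ⟨v18, hv18, hR⟩ := htmp
    simp -failIfUnchanged (disch := omega) only [Operand.write, Operand.read, merge_apply_of_lt,
      merge_apply_of_le, Function.update_self, Function.update_of_ne, update_merge_of_lt,
      update_merge_of_le, Nat.add_zero, Nat.zero_add, BinOp.eval_mod, BinOp.eval_eq, BinOp.eval_band,
      BinOp.eval_shr, BinOp.eval_div, BinOp.eval_lt, BinOp.eval_add_of_lt, BinOp.eval_sub_of_le,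
      BinOp.eval_mul_of_lt, h2, h3, h6, h7, h9, h11, h17, h18, h19, h20, h21, h30, ht1, htu, htv, hsrc, hp, htt, hcv] at hv18 hR; subst hv18
    have htmp := execOps_cons_fwd hR; clear hR; obtain ⟨v19, hv19, hR⟩ := htmp
    simp -failIfUnchanged (disch := omega) only [Operand.write, Operand.read, merge_apply_of_lt,
      merge_apply_of_le, Function.update_self, Function.update_of_ne, update_merge_of_lt,
      update_merge_of_le, Nat.add_zero, Nat.zero_add, BinOp.eval_mod, BinOp.eval_eq, BinOp.eval_band,
      BinOp.eval_shr, BinOp.eval_div, BinOp.eval_lt, BinOp.eval_add_of_lt, BinOp.eval_sub_of_le,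
      BinOp.eval_mul_of_lt, h2, h3, h6, h7, h9, h11, h17, h18, h19, h20, h21, h30, ht1, htu, htv, hsrc, hp, htt, hcv] at hv19 hR; subst hv19
    have htmp := execOps_cons_fwd hR; clear hR; obtain ⟨v20, hv20, hR⟩ := htmp
    simp -failIfUnchanged (disch := omega) only [Operand.write, Operand.read, merge_apply_of_lt,
      merge_apply_of_le, Function.update_self, Function.update_of_ne, update_merge_of_lt,
      update_merge_of_le, Nat.add_zero, Nat.zero_add, BinOp.eval_mod, BinOp.eval_eq, BinOp.eval_band,
      BinOp.eval_shr, BinOp.eval_div, BinOp.eval_lt, BinOp.eval_add_of_lt, BinOp.eval_sub_of_le,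
      BinOp.eval_mul_of_lt, h2, h3, h6, h7, h9, h11, h17, h18, h19, h20, h21, h30, ht1, htu, htv, hsrc, hp, htt, hcv] at hv20 hR; subst hv20
    have htmp := execOps_cons_fwd hR; clear hR; obtain ⟨v21, hv21, hR⟩ := htmp
    simp -failIfUnchanged (disch := omega) only [Operand.write, Operand.read, merge_apply_of_lt,
      merge_apply_of_le, Function.update_self, Function.update_of_ne, update_merge_of_lt,
      update_merge_of_le, Nat.add_zero, Nat.zero_add, BinOp.eval_mod, BinOp.eval_eq, BinOp.eval_band,
      BinOp.eval_shr, BinOp.eval_div, BinOp.eval_lt, BinOp.eval_add_of_lt, BinOp.eval_sub_of_le,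
      BinOp.eval_mul_of_lt, h2, h3, h6, h7, h9, h11, h17, h18, h19, h20, h21, h30, ht1, htu, htv, hsrc, hp, htt, hcv] at hv21 hR; subst hv21
    have htmp := execOps_cons_fwd hR; clear hR; obtain ⟨v22, hv22, hR⟩ := htmp
    simp -failIfUnchanged (disch := omega) only [Operand.write, Operand.read, merge_apply_of_lt,
      merge_apply_of_le, Function.update_self, Function.update_of_ne, update_merge_of_lt,
      update_merge_of_le, Nat.add_zero, Nat.zero_add, BinOp.eval_mod, BinOp.eval_eq, BinOp.eval_band,
      BinOp.eval_shr, BinOp.eval_div, BinOp.eval_lt, BinOp.eval_add_of_lt, BinOp.eval_sub_of_le,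
      BinOp.eval_mul_of_lt, h2, h3, h6, h7, h9, h11, h17, h18, h19, h20, h21, h30, ht1, htu, htv, hsrc, hp, htt, hcv] at hv22 hR; subst hv22
    have htmp := execOps_cons_fwd hR; clear hR; obtain ⟨v23, hv23, hR⟩ := htmp
    simp -failIfUnchanged (disch := omega) only [Operand.write, Operand.read, merge_apply_of_lt,
      merge_apply_of_le, Function.update_self, Function.update_of_ne, update_merge_of_lt,
      update_merge_of_le, Nat.add_zero, Nat.zero_add, BinOp.eval_mod, BinOp.eval_eq, BinOp.eval_band,
      BinOp.eval_shr, BinOp.eval_div, BinOp.eval_lt, BinOp.eval_add_of_lt, BinOp.eval_sub_of_le,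
      BinOp.eval_mul_of_lt, h2, h3, h6, h7, h9, h11, h17, h18, h19, h20, h21, h30, ht1, htu, htv, hsrc, hp, htt, hcv] at hv23 hR; subst hv23
    have htmp := execOps_cons_fwd hR; clear hR; obtain ⟨v24, hv24, hR⟩ := htmp
    simp -failIfUnchanged (disch := omega) only [Operand.write, Operand.read, merge_apply_of_lt,
      merge_apply_of_le, Function.update_self, Function.update_of_ne, update_merge_of_lt,
      update_merge_of_le, Nat.add_zero, Nat.zero_add, BinOp.eval_mod, BinOp.eval_eq, BinOp.eval_band,
      BinOp.eval_shr, BinOp.eval_div, BinOp.eval_lt, BinOp.eval_add_of_lt, BinOp.eval_sub_of_le,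
      BinOp.eval_mul_of_lt, h2, h3, h6, h7, h9, h11, h17, h18, h19, h20, h21, h30, ht1, htu, htv, hsrc, hp, htt, hcv] at hv24 hR; subst hv24
    have htmp := execOps_cons_fwd hR; clear hR; obtain ⟨v25, hv25, hR⟩ := htmp
    simp -failIfUnchanged (disch := omega) only [Operand.write, Operand.read, merge_apply_of_lt,
      merge_apply_of_le, Function.update_self, Function.update_of_ne, update_merge_of_lt,
      update_merge_of_le, Nat.add_zero, Nat.zero_add, BinOp.eval_mod, BinOp.eval_eq, BinOp.eval_band,
      BinOp.eval_shr, BinOp.eval_div, BinOp.eval_lt, BinOp.eval_add_of_lt, BinOp.eval_sub_of_le,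
      BinOp.eval_mul_of_lt, h2, h3, h6, h7, h9, h11, h17, h18, h19, h20, h21, h30, ht1, htu, htv, hsrc, hp, htt, hcv] at hv25 hR; subst hv25
    simp only [execOps_nil] at hR; subst hR
    rw [heapA_succ W Q H₁ ht htuv hv, hcvr]
    refine ⟨_, rfl, ?_, ?_⟩
    · refine ⟨?_, ?_, ?_, ?_, ?_, ?_, ?_, ?_, ?_, ?_, ?_, ?_, ?_, ?_, ?_, ?_⟩ <;>
        simp only [Function.update_self, Function.update_of_ne, ne_eq, Nat.reduceEqDiff,
          not_false_eq_true, h2, h3, h6, h7, h8, h9, h10, h11, h15, h16, h17, h18, h19, h20, h21, h22]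
    · simp only [Function.update_self, Function.update_of_ne, ne_eq, Nat.reduceEqDiff, not_false_eq_true]
      omega
  obtain ⟨S', hR, h⟩ := key _ rfl
  exact ⟨S', Exec.block' bodyA qs hR, h⟩

/-- **Semantics of loop A**: from the setup data (`heapA 0`), `n²` iterations reach `heapA (n²)`
within `27 n² + 1` steps, the layout registers intact. [folklore] -/
theorem loopA_spec {Q : ℕ} {S H₁ : ℕ → ℕ} (hRg : Regs n Q S) (h30 : S 30 = n * n)
    (hH₁ : ∀ t', t' < n * n → H₁ (pC n + t') = code W t') (hcode : ∀ t', code W t' ≤ 2 * Q)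
    (hQ2 : 2 ≤ Q) (hF : pTop n < 2 ^ w) (hQw : 8 * Q < 2 ^ w) (qs : List (List ℕ)) :
    ∃ S', ExecLE w O (whilenz (.dir 30) (block bodyA)) ⟨merge S (heapA W Q H₁ 0), qs⟩
        ⟨merge S' (heapA W Q H₁ (n * n)), qs⟩ (n * n * 27 + 1) ∧ Regs n Q S' := by
  have h0 : (fun i (st : Store) => ∃ S, st = ⟨merge S (heapA W Q H₁ i), qs⟩ ∧ Regs n Q S ∧ S 30 = n * n - i)
      0 ⟨merge S (heapA W Q H₁ 0), qs⟩ := ⟨S, rfl, hRg, by simpa using h30⟩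
  obtain ⟨st', hex, S', hst, hRg', -⟩ :=
    ExecLE.whilenz_invariant (w := w) (O := O) (x := .dir 30) (s := block bodyA) (n * n) 25
      (fun i st => ∃ S, st = ⟨merge S (heapA W Q H₁ i), qs⟩ ∧ Regs n Q S ∧ S 30 = n * n - i)
      (fun i hi st hst => by
        obtain ⟨S₀, rfl, hRg₀, h30₀⟩ := hst
        refine ⟨by rw [Operand.read_dir_merge (by decide), h30₀]; omega, ?_⟩
        obtain ⟨S₁, hex, hRg₁, h30₁⟩ := bodyA_spec (O := O) W hRg₀ hi h30₀ hH₁ hcode hQ2 hF hQw qs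
        exact ⟨_, hex.execLE, S₁, rfl, hRg₁, h30₁⟩)
      (fun st hst => by
        obtain ⟨S₀, rfl, -, h30₀⟩ := hst
        rw [Operand.read_dir_merge (by decide), h30₀]; omega)
      h0
  subst hst
  exact ⟨S', hex, hRg'⟩

/-! ## Loop B -/

-- The symbolic execution below uses one uniform `simp only` read-normaliser per instruction;
-- not every lemma of the set fires at every instruction.
set_option linter.unusedSimpArgs false in
/-- Before loop B: the counter `r30 := n`. [folklore] -/
theorem preB_spec {Q : ℕ} {S : ℕ → ℕ} (H : ℕ → ℕ) (hRg : Regs n Q S) (hF : pTop n < 2 ^ w)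
    (qs : List (List ℕ)) :
    ∃ S', Exec w O (block preB) ⟨merge S H, qs⟩ ⟨merge S' H, qs⟩ 1 ∧ Regs n Q S' ∧ S' 30 = n := by
  have hT : pTop n = 18 * (n * n) + 8 * n + 107 := rfl
  have hnn : n ≤ n * n := Nat.le_mul_self n
  obtain ⟨h2, h3, h6, h7, h8, h9, h10, h11, h15, h16, h17, h18, h19, h20, h21, h22⟩ := hRg
  have key : ∀ R, execOps w (merge S H) preB = R → ∃ S', R = merge S' H ∧ Regs n Q S' ∧ S' 30 = n := by
    intro R hR
    unfold preB at hR
    have htmp := execOps_cons_fwd hR; clear hR; obtain ⟨v1, hv1, hR⟩ := htmp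
    simp -failIfUnchanged (disch := omega) only [Operand.write, Operand.read, merge_apply_of_lt,
      merge_apply_of_le, Function.update_self, Function.update_of_ne, update_merge_of_lt,
      update_merge_of_le, Nat.add_zero, Nat.zero_add, BinOp.eval_mod, BinOp.eval_eq, BinOp.eval_band,
      BinOp.eval_shr, BinOp.eval_div, BinOp.eval_lt, BinOp.eval_add_of_lt, BinOp.eval_sub_of_le,
      BinOp.eval_mul_of_lt, h2] at hv1 hR; subst hv1
    simp only [execOps_nil] at hR; subst hR
    refine ⟨_, rfl, ?_, ?_⟩
    · refine ⟨?_, ?_, ?_, ?_, ?_, ?_, ?_, ?_, ?_, ?_, ?_, ?_, ?_, ?_, ?_, ?_⟩ <;>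
        simp only [Function.update_self, Function.update_of_ne, ne_eq, Nat.reduceEqDiff,
          not_false_eq_true, h2, h3, h6, h7, h8, h9, h10, h11, h15, h16, h17, h18, h19, h20, h21, h22]
    · simp only [Function.update_self]
  obtain ⟨S', hR, h⟩ := key _ rfl
  exact ⟨S', Exec.block' preB qs hR, h⟩

-- The symbolic execution below uses one uniform `simp only` read-normaliser per instruction;
-- not every lemma of the set fires at every instruction.
set_option linter.unusedSimpArgs false in
/-- **One iteration of loop B** (`u < n`, counter `r30 = n - u`): `bodyB` takes the data from
`heapB u` to `heapB (u + 1)` in `17` steps, keeping the layout registers and counting down.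
[folklore] -/
theorem bodyB_spec {Q : ℕ} {S H₁ : ℕ → ℕ} (hRg : Regs n Q S) {u : ℕ} (hu : u < n)
    (h30 : S 30 = n - u) (hQ2 : 2 ≤ Q) (hF : pTop n < 2 ^ w) (hQw : 8 * Q < 2 ^ w)
    (qs : List (List ℕ)) :
    ∃ S', Exec w O (block bodyB) ⟨merge S (heapB W Q H₁ u), qs⟩ ⟨merge S' (heapB W Q H₁ (u + 1)), qs⟩ 17 ∧
      Regs n Q S' ∧ S' 30 = n - (u + 1) := by
  have hC : pC n = n * n + 103 := rfl
  have hQ' : pQ n = 2 * (n * n) + 103 := rfl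
  have hT : pTop n = 18 * (n * n) + 8 * n + 107 := rfl
  have hnN := n_mul_N n
  have hNN := N_mul_N n
  obtain ⟨h2, h3, h6, h7, h8, h9, h10, h11, h15, h16, h17, h18, h19, h20, h21, h22⟩ := hRg
  have huN : u * (4 * n + 1) + (4 * n + 1) ≤ n * (4 * n + 1) := by
    have := Nat.mul_le_mul_right (4 * n + 1) (Nat.succ_le_of_lt hu); rwa [Nat.succ_mul] at this
  have hu1 : n - (n - u) = u := by omega
  have key : ∀ R, execOps w (merge S (heapB W Q H₁ u)) bodyB = R →
      ∃ S', R = merge S' (heapB W Q H₁ (u + 1)) ∧ Regs n Q S' ∧ S' 30 = n - (u + 1) := by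
    intro R hR
    unfold bodyB at hR
    have htmp := execOps_cons_fwd hR; clear hR; obtain ⟨v1, hv1, hR⟩ := htmp
    simp -failIfUnchanged (disch := omega) only [Operand.write, Operand.read, merge_apply_of_lt,
      merge_apply_of_le, Function.update_self, Function.update_of_ne, update_merge_of_lt,
      update_merge_of_le, Nat.add_zero, Nat.zero_add, BinOp.eval_mod, BinOp.eval_eq, BinOp.eval_band,
      BinOp.eval_shr, BinOp.eval_div, BinOp.eval_lt, BinOp.eval_add_of_lt, BinOp.eval_sub_of_le,
      BinOp.eval_mul_of_lt, h2, h3, h7, h8, h11, h17, h18, h19, h21, h22, h30, hu1] at hv1 hR; subst hv1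
    have htmp := execOps_cons_fwd hR; clear hR; obtain ⟨v2, hv2, hR⟩ := htmp
    simp -failIfUnchanged (disch := omega) only [Operand.write, Operand.read, merge_apply_of_lt,
      merge_apply_of_le, Function.update_self, Function.update_of_ne, update_merge_of_lt,
      update_merge_of_le, Nat.add_zero, Nat.zero_add, BinOp.eval_mod, BinOp.eval_eq, BinOp.eval_band,
      BinOp.eval_shr, BinOp.eval_div, BinOp.eval_lt, BinOp.eval_add_of_lt, BinOp.eval_sub_of_le,
      BinOp.eval_mul_of_lt, h2, h3, h7, h8, h11, h17, h18, h19, h21, h22, h30, hu1] at hv2 hR; subst hv2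
    have htmp := execOps_cons_fwd hR; clear hR; obtain ⟨v3, hv3, hR⟩ := htmp
    simp -failIfUnchanged (disch := omega) only [Operand.write, Operand.read, merge_apply_of_lt,
      merge_apply_of_le, Function.update_self, Function.update_of_ne, update_merge_of_lt,
      update_merge_of_le, Nat.add_zero, Nat.zero_add, BinOp.eval_mod, BinOp.eval_eq, BinOp.eval_band,
      BinOp.eval_shr, BinOp.eval_div, BinOp.eval_lt, BinOp.eval_add_of_lt, BinOp.eval_sub_of_le,
      BinOp.eval_mul_of_lt, h2, h3, h7, h8, h11, h17, h18, h19, h21, h22, h30, hu1] at hv3 hR; subst hv3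
    have htmp := execOps_cons_fwd hR; clear hR; obtain ⟨v4, hv4, hR⟩ := htmp
    simp -failIfUnchanged (disch := omega) only [Operand.write, Operand.read, merge_apply_of_lt,
      merge_apply_of_le, Function.update_self, Function.update_of_ne, update_merge_of_lt,
      update_merge_of_le, Nat.add_zero, Nat.zero_add, BinOp.eval_mod, BinOp.eval_eq, BinOp.eval_band,
      BinOp.eval_shr, BinOp.eval_div, BinOp.eval_lt, BinOp.eval_add_of_lt, BinOp.eval_sub_of_le,
      BinOp.eval_mul_of_lt, h2, h3, h7, h8, h11, h17, h18, h19, h21, h22, h30, hu1] at hv4 hR; subst hv4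
    have htmp := execOps_cons_fwd hR; clear hR; obtain ⟨v5, hv5, hR⟩ := htmp
    simp -failIfUnchanged (disch := omega) only [Operand.write, Operand.read, merge_apply_of_lt,
      merge_apply_of_le, Function.update_self, Function.update_of_ne, update_merge_of_lt,
      update_merge_of_le, Nat.add_zero, Nat.zero_add, BinOp.eval_mod, BinOp.eval_eq, BinOp.eval_band,
      BinOp.eval_shr, BinOp.eval_div, BinOp.eval_lt, BinOp.eval_add_of_lt, BinOp.eval_sub_of_le,
      BinOp.eval_mul_of_lt, h2, h3, h7, h8, h11, h17, h18, h19, h21, h22, h30, hu1] at hv5 hR; subst hv5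
    have htmp := execOps_cons_fwd hR; clear hR; obtain ⟨v6, hv6, hR⟩ := htmp
    simp -failIfUnchanged (disch := omega) only [Operand.write, Operand.read, merge_apply_of_lt,
      merge_apply_of_le, Function.update_self, Function.update_of_ne, update_merge_of_lt,
      update_merge_of_le, Nat.add_zero, Nat.zero_add, BinOp.eval_mod, BinOp.eval_eq, BinOp.eval_band,
      BinOp.eval_shr, BinOp.eval_div, BinOp.eval_lt, BinOp.eval_add_of_lt, BinOp.eval_sub_of_le,
      BinOp.eval_mul_of_lt, h2, h3, h7, h8, h11, h17, h18, h19, h21, h22, h30, hu1] at hv6 hR; subst hv6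
    have htmp := execOps_cons_fwd hR; clear hR; obtain ⟨v7, hv7, hR⟩ := htmp
    simp -failIfUnchanged (disch := omega) only [Operand.write, Operand.read, merge_apply_of_lt,
      merge_apply_of_le, Function.update_self, Function.update_of_ne, update_merge_of_lt,
      update_merge_of_le, Nat.add_zero, Nat.zero_add, BinOp.eval_mod, BinOp.eval_eq, BinOp.eval_band,
      BinOp.eval_shr, BinOp.eval_div, BinOp.eval_lt, BinOp.eval_add_of_lt, BinOp.eval_sub_of_le,
      BinOp.eval_mul_of_lt, h2, h3, h7, h8, h11, h17, h18, h19, h21, h22, h30, hu1] at hv7 hR; subst hv7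
    have htmp := execOps_cons_fwd hR; clear hR; obtain ⟨v8, hv8, hR⟩ := htmp
    simp -failIfUnchanged (disch := omega) only [Operand.write, Operand.read, merge_apply_of_lt,
      merge_apply_of_le, Function.update_self, Function.update_of_ne, update_merge_of_lt,
      update_merge_of_le, Nat.add_zero, Nat.zero_add, BinOp.eval_mod, BinOp.eval_eq, BinOp.eval_band,
      BinOp.eval_shr, BinOp.eval_div, BinOp.eval_lt, BinOp.eval_add_of_lt, BinOp.eval_sub_of_le,
      BinOp.eval_mul_of_lt, h2, h3, h7, h8, h11, h17, h18, h19, h21, h22, h30, hu1] at hv8 hR; subst hv8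
    have htmp := execOps_cons_fwd hR; clear hR; obtain ⟨v9, hv9, hR⟩ := htmp
    simp -failIfUnchanged (disch := omega) only [Operand.write, Operand.read, merge_apply_of_lt,
      merge_apply_of_le, Function.update_self, Function.update_of_ne, update_merge_of_lt,
      update_merge_of_le, Nat.add_zero, Nat.zero_add, BinOp.eval_mod, BinOp.eval_eq, BinOp.eval_band,
      BinOp.eval_shr, BinOp.eval_div, BinOp.eval_lt, BinOp.eval_add_of_lt, BinOp.eval_sub_of_le,
      BinOp.eval_mul_of_lt, h2, h3, h7, h8, h11, h17, h18, h19, h21, h22, h30, hu1] at hv9 hR; subst hv9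
    have htmp := execOps_cons_fwd hR; clear hR; obtain ⟨v10, hv10, hR⟩ := htmp
    simp -failIfUnchanged (disch := omega) only [Operand.write, Operand.read, merge_apply_of_lt,
      merge_apply_of_le, Function.update_self, Function.update_of_ne, update_merge_of_lt,
      update_merge_of_le, Nat.add_zero, Nat.zero_add, BinOp.eval_mod, BinOp.eval_eq, BinOp.eval_band,
      BinOp.eval_shr, BinOp.eval_div, BinOp.eval_lt, BinOp.eval_add_of_lt, BinOp.eval_sub_of_le,
      BinOp.eval_mul_of_lt, h2, h3, h7, h8, h11, h17, h18, h19, h21, h22, h30, hu1] at hv10 hR; subst hv10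
    have htmp := execOps_cons_fwd hR; clear hR; obtain ⟨v11, hv11, hR⟩ := htmp
    simp -failIfUnchanged (disch := omega) only [Operand.write, Operand.read, merge_apply_of_lt,
      merge_apply_of_le, Function.update_self, Function.update_of_ne, update_merge_of_lt,
      update_merge_of_le, Nat.add_zero, Nat.zero_add, BinOp.eval_mod, BinOp.eval_eq, BinOp.eval_band,
      BinOp.eval_shr, BinOp.eval_div, BinOp.eval_lt, BinOp.eval_add_of_lt, BinOp.eval_sub_of_le,
      BinOp.eval_mul_of_lt, h2, h3, h7, h8, h11, h17, h18, h19, h21, h22, h30, hu1] at hv11 hR; subst hv11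
    have htmp := execOps_cons_fwd hR; clear hR; obtain ⟨v12, hv12, hR⟩ := htmp
    simp -failIfUnchanged (disch := omega) only [Operand.write, Operand.read, merge_apply_of_lt,
      merge_apply_of_le, Function.update_self, Function.update_of_ne, update_merge_of_lt,
      update_merge_of_le, Nat.add_zero, Nat.zero_add, BinOp.eval_mod, BinOp.eval_eq, BinOp.eval_band,
      BinOp.eval_shr, BinOp.eval_div, BinOp.eval_lt, BinOp.eval_add_of_lt, BinOp.eval_sub_of_le,
      BinOp.eval_mul_of_lt, h2, h3, h7, h8, h11, h17, h18, h19, h21, h22, h30, hu1] at hv12 hR; subst hv12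
    have htmp := execOps_cons_fwd hR; clear hR; obtain ⟨v13, hv13, hR⟩ := htmp
    simp -failIfUnchanged (disch := omega) only [Operand.write, Operand.read, merge_apply_of_lt,
      merge_apply_of_le, Function.update_self, Function.update_of_ne, update_merge_of_lt,
      update_merge_of_le, Nat.add_zero, Nat.zero_add, BinOp.eval_mod, BinOp.eval_eq, BinOp.eval_band,
      BinOp.eval_shr, BinOp.eval_div, BinOp.eval_lt, BinOp.eval_add_of_lt, BinOp.eval_sub_of_le,
      BinOp.eval_mul_of_lt, h2, h3, h7, h8, h11, h17, h18, h19, h21, h22, h30, hu1] at hv13 hR; subst hv13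
    have htmp := execOps_cons_fwd hR; clear hR; obtain ⟨v14, hv14, hR⟩ := htmp
    simp -failIfUnchanged (disch := omega) only [Operand.write, Operand.read, merge_apply_of_lt,
      merge_apply_of_le, Function.update_self, Function.update_of_ne, update_merge_of_lt,
      update_merge_of_le, Nat.add_zero, Nat.zero_add, BinOp.eval_mod, BinOp.eval_eq, BinOp.eval_band,
      BinOp.eval_shr, BinOp.eval_div, BinOp.eval_lt, BinOp.eval_add_of_lt, BinOp.eval_sub_of_le,
      BinOp.eval_mul_of_lt, h2, h3, h7, h8, h11, h17, h18, h19, h21, h22, h30, hu1] at hv14 hR; subst hv14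
    have htmp := execOps_cons_fwd hR; clear hR; obtain ⟨v15, hv15, hR⟩ := htmp
    simp -failIfUnchanged (disch := omega) only [Operand.write, Operand.read, merge_apply_of_lt,
      merge_apply_of_le, Function.update_self, Function.update_of_ne, update_merge_of_lt,
      update_merge_of_le, Nat.add_zero, Nat.zero_add, BinOp.eval_mod, BinOp.eval_eq, BinOp.eval_band,
      BinOp.eval_shr, BinOp.eval_div, BinOp.eval_lt, BinOp.eval_add_of_lt, BinOp.eval_sub_of_le,
      BinOp.eval_mul_of_lt, h2, h3, h7, h8, h11, h17, h18, h19, h21, h22, h30, hu1] at hv15 hR; subst hv15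
    have htmp := execOps_cons_fwd hR; clear hR; obtain ⟨v16, hv16, hR⟩ := htmp
    simp -failIfUnchanged (disch := omega) only [Operand.write, Operand.read, merge_apply_of_lt,
      merge_apply_of_le, Function.update_self, Function.update_of_ne, update_merge_of_lt,
      update_merge_of_le, Nat.add_zero, Nat.zero_add, BinOp.eval_mod, BinOp.eval_eq, BinOp.eval_band,
      BinOp.eval_shr, BinOp.eval_div, BinOp.eval_lt, BinOp.eval_add_of_lt, BinOp.eval_sub_of_le,
      BinOp.eval_mul_of_lt, h2, h3, h7, h8, h11, h17, h18, h19, h21, h22, h30, hu1] at hv16 hR; subst hv16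
    have htmp := execOps_cons_fwd hR; clear hR; obtain ⟨v17, hv17, hR⟩ := htmp
    simp -failIfUnchanged (disch := omega) only [Operand.write, Operand.read, merge_apply_of_lt,
      merge_apply_of_le, Function.update_self, Function.update_of_ne, update_merge_of_lt,
      update_merge_of_le, Nat.add_zero, Nat.zero_add, BinOp.eval_mod, BinOp.eval_eq, BinOp.eval_band,
      BinOp.eval_shr, BinOp.eval_div, BinOp.eval_lt, BinOp.eval_add_of_lt, BinOp.eval_sub_of_le,
      BinOp.eval_mul_of_lt, h2, h3, h7, h8, h11, h17, h18, h19, h21, h22, h30, hu1] at hv17 hR; subst hv17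
    simp only [execOps_nil] at hR; subst hR
    rw [heapB_succ W Q H₁ hu]
    refine ⟨_, rfl, ?_, ?_⟩
    · refine ⟨?_, ?_, ?_, ?_, ?_, ?_, ?_, ?_, ?_, ?_, ?_, ?_, ?_, ?_, ?_, ?_⟩ <;>
        simp only [Function.update_self, Function.update_of_ne, ne_eq, Nat.reduceEqDiff,
          not_false_eq_true, h2, h3, h6, h7, h8, h9, h10, h11, h15, h16, h17, h18, h19, h20, h21, h22]
    · simp only [Function.update_self, Function.update_of_ne, ne_eq, Nat.reduceEqDiff, not_false_eq_true]
      omega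
  obtain ⟨S', hR, h⟩ := key _ rfl
  exact ⟨S', Exec.block' bodyB qs hR, h⟩

/-- **Semantics of loop B**: from `heapB 0`, `n` iterations reach `heapB n` within `19 n + 1` steps,
the layout registers intact. [folklore] -/
theorem loopB_spec {Q : ℕ} {S H₁ : ℕ → ℕ} (hRg : Regs n Q S) (h30 : S 30 = n) (hQ2 : 2 ≤ Q)
    (hF : pTop n < 2 ^ w) (hQw : 8 * Q < 2 ^ w) (qs : List (List ℕ)) :
    ∃ S', ExecLE w O (whilenz (.dir 30) (block bodyB)) ⟨merge S (heapB W Q H₁ 0), qs⟩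
        ⟨merge S' (heapB W Q H₁ n), qs⟩ (n * 19 + 1) ∧ Regs n Q S' := by
  have h0 : (fun i (st : Store) => ∃ S, st = ⟨merge S (heapB W Q H₁ i), qs⟩ ∧ Regs n Q S ∧ S 30 = n - i)
      0 ⟨merge S (heapB W Q H₁ 0), qs⟩ := ⟨S, rfl, hRg, by simpa using h30⟩
  obtain ⟨st', hex, S', hst, hRg', -⟩ :=
    ExecLE.whilenz_invariant (w := w) (O := O) (x := .dir 30) (s := block bodyB) n 17
      (fun i st => ∃ S, st = ⟨merge S (heapB W Q H₁ i), qs⟩ ∧ Regs n Q S ∧ S 30 = n - i)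
      (fun i hi st hst => by
        obtain ⟨S₀, rfl, hRg₀, h30₀⟩ := hst
        refine ⟨by rw [Operand.read_dir_merge (by decide), h30₀]; omega, ?_⟩
        obtain ⟨S₁, hex, hRg₁, h30₁⟩ := bodyB_spec (O := O) W (H₁ := H₁) hRg₀ hi h30₀ hQ2 hF hQw qs
        exact ⟨_, hex.execLE, S₁, rfl, hRg₁, h30₁⟩)
      (fun st hst => by
        obtain ⟨S₀, rfl, -, h30₀⟩ := hst
        rw [Operand.read_dir_merge (by decide), h30₀]; omega)
      h0
  subst hst
  exact ⟨S', hex, hRg'⟩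

/-! ## The query segment and the finish -/

/-- **The query segment**: the header `N = 4 n + 1` and, row-major, the `N²` final cell values
`valF`. [folklore] -/
def qseg (Q : ℕ) : List ℕ :=
  (4 * n + 1) :: List.ofFn fun m : Fin ((4 * n + 1) * (4 * n + 1)) => valF W Q (m / (4 * n + 1)) (m % (4 * n + 1))

/-- The query segment has the length of an encoded `N × N` matrix. [folklore] -/
theorem qseg_length (Q : ℕ) : (qseg W Q).length = (4 * n + 1) * (4 * n + 1) + 1 := by
  rw [qseg, List.length_cons, List.length_ofFn]

/-- **Reading the query block**: if the header cell holds `N` and cell `(U, V)` holds `valF W Q U V`,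
the segment handed to the oracle is `qseg W Q`. [folklore] -/
theorem readSeg_query {Q : ℕ} {H : ℕ → ℕ} (hQ₀ : H (pQ n) = 4 * n + 1)
    (hcell : ∀ U V, U < 4 * n + 1 → V < 4 * n + 1 → H (pQ n + 1 + (U * (4 * n + 1) + V)) = valF W Q U V) :
    readSeg H (pQ n) ((4 * n + 1) * (4 * n + 1) + 1) = qseg W Q := by
  refine readSeg_eq_of_forall (qseg_length W Q) fun j hj => ?_
  rcases j with _ | m
  · simp [qseg, hQ₀]
  · have hm : m < (4 * n + 1) * (4 * n + 1) := by omega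
    have hN : 0 < 4 * n + 1 := by omega
    have hdm := Nat.div_add_mod' m (4 * n + 1)
    have key := hcell (m / (4 * n + 1)) (m % (4 * n + 1)) (Nat.div_lt_of_lt_mul hm) (Nat.mod_lt _ hN)
    rw [show pQ n + (m + 1) = pQ n + 1 + (m / (4 * n + 1) * (4 * n + 1) + m % (4 * n + 1)) by omega, key]
    simp only [qseg, List.getElem_cons_succ, List.getElem_ofFn]

-- The symbolic execution below uses one uniform `simp only` read-normaliser per instruction;
-- not every lemma of the set fires at every instruction.
set_option linter.unusedSimpArgs false in
/-- **The finish**: with the radius code `a` at `pR n + 1`, `finishOps` sets `mem[1] := (a = 6Q - 1)`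
and `mem[0] := 1`. [folklore] -/
theorem finish_spec {Q : ℕ} {S : ℕ → ℕ} (H : ℕ → ℕ) (hRg : Regs n Q S) {a : ℕ} (hans : H (pR n + 1) = a)
    (hF : pTop n < 2 ^ w) (qs : List (List ℕ)) :
    ∃ S', Exec w O (block finishOps) ⟨merge S H, qs⟩ ⟨merge S' H, qs⟩ 3 ∧ S' 0 = 1 ∧
      S' 1 = (if a = 6 * Q - 1 then 1 else 0) := by
  have hRR : pR n = 18 * (n * n) + 8 * n + 105 := rfl
  have hT : pTop n = 18 * (n * n) + 8 * n + 107 := rfl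
  obtain ⟨h2, h3, h6, h7, h8, h9, h10, h11, h15, h16, h17, h18, h19, h20, h21, h22⟩ := hRg
  have key : ∀ R, execOps w (merge S H) finishOps = R →
      ∃ S', R = merge S' H ∧ S' 0 = 1 ∧ S' 1 = (if a = 6 * Q - 1 then 1 else 0) := by
    intro R hR
    unfold finishOps at hR
    have htmp := execOps_cons_fwd hR; clear hR; obtain ⟨v1, hv1, hR⟩ := htmp
    simp -failIfUnchanged (disch := omega) only [Operand.write, Operand.read, merge_apply_of_lt,
      merge_apply_of_le, Function.update_self, Function.update_of_ne, update_merge_of_lt,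
      update_merge_of_le, Nat.add_zero, Nat.zero_add, BinOp.eval_mod, BinOp.eval_eq, BinOp.eval_band,
      BinOp.eval_shr, BinOp.eval_div, BinOp.eval_lt, BinOp.eval_add_of_lt, BinOp.eval_sub_of_le,
      BinOp.eval_mul_of_lt, h8, h16, hans] at hv1 hR; subst hv1
    have htmp := execOps_cons_fwd hR; clear hR; obtain ⟨v2, hv2, hR⟩ := htmp
    simp -failIfUnchanged (disch := omega) only [Operand.write, Operand.read, merge_apply_of_lt,
      merge_apply_of_le, Function.update_self, Function.update_of_ne, update_merge_of_lt,
      update_merge_of_le, Nat.add_zero, Nat.zero_add, BinOp.eval_mod, BinOp.eval_eq, BinOp.eval_band,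
      BinOp.eval_shr, BinOp.eval_div, BinOp.eval_lt, BinOp.eval_add_of_lt, BinOp.eval_sub_of_le,
      BinOp.eval_mul_of_lt, h8, h16, hans] at hv2 hR; subst hv2
    have htmp := execOps_cons_fwd hR; clear hR; obtain ⟨v3, hv3, hR⟩ := htmp
    simp -failIfUnchanged (disch := omega) only [Operand.write, Operand.read, merge_apply_of_lt,
      merge_apply_of_le, Function.update_self, Function.update_of_ne, update_merge_of_lt,
      update_merge_of_le, Nat.add_zero, Nat.zero_add, BinOp.eval_mod, BinOp.eval_eq, BinOp.eval_band,
      BinOp.eval_shr, BinOp.eval_div, BinOp.eval_lt, BinOp.eval_add_of_lt, BinOp.eval_sub_of_le,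
      BinOp.eval_mul_of_lt, h8, h16, hans] at hv3 hR; subst hv3
    simp only [execOps_nil] at hR; subst hR
    refine ⟨_, rfl, ?_, ?_⟩ <;>
      simp only [Function.update_self, Function.update_of_ne, ne_eq, Nat.reduceEqDiff, not_false_eq_true]
  obtain ⟨S', hR, h⟩ := key _ rfl
  exact ⟨S', Exec.block' finishOps qs hR, h⟩

/-! ## The whole run -/

/-- **Semantics of the program.** On the encoding of `W`, at a word size accommodating the input,
`pTop n` and `8Q`, with all weight codes `≤ 2Q`, and for an oracle whose answer to `qseg W Q` is a
single word `< 2 ^ w`, `prog c` ends within `34 n² + 19 n + 45 + c` steps with `mem 0 = 1` and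
`mem 1 = [answer = 6Q - 1]`, having made the single query `qseg W Q` (`Q = wQ n c`). [folklore] -/
theorem prog_spec (c : ℕ) (hwid : inputWidth (inp W) ≤ w) (hF : pTop n < 2 ^ w)
    (hQw : 8 * wQ n c < 2 ^ w) (hcode : ∀ t, code W t ≤ 2 * wQ n c)
    (hlen : (O (qseg W (wQ n c))).length = 1) (hwv : ∀ v ∈ O (qseg W (wQ n c)), v < 2 ^ w) :
    ∃ st' : Store, ExecLE w O (prog c) ⟨(init w (inp W)).mem, []⟩ st' (34 * (n * n) + 19 * n + 45 + c) ∧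
      st'.queries = [qseg W (wQ n c)] ∧ st'.mem 0 = 1 ∧
      st'.mem 1 = (if (O (qseg W (wQ n c))).getD 0 0 = 6 * wQ n c - 1 then 1 else 0) := by
  have hC : pC n = n * n + 103 := rfl
  have hQ' : pQ n = 2 * (n * n) + 103 := rfl
  have hRR : pR n = 18 * (n * n) + 8 * n + 105 := rfl
  have hT : pTop n = 18 * (n * n) + 8 * n + 107 := rfl
  have hNN := N_mul_N n
  have hnn : n ≤ n * n := Nat.le_mul_self n
  have hQ2 : 2 ≤ wQ n c := by unfold wQ; omega
  have hpow : n ^ c < 2 ^ w := by unfold wQ at hQw; omega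
  obtain ⟨a, ha⟩ : ∃ a, O (qseg W (wQ n c)) = [a] := List.length_eq_one_iff.1 hlen
  have haw : a < 2 ^ w := hwv a (by rw [ha]; simp)
  -- relocate
  have hx : ∀ v ∈ inp W, v < 2 ^ w := fun v hv =>
    lt_of_lt_of_le (lt_two_pow_inputWidth_of_mem _ _ hv) (Nat.pow_le_pow_right Nat.two_pos hwid)
  have hrel := relocate_exec (w := w) (O := O) (x := inp W) (by rw [inp_length]; omega) hx
    (by rw [inp_length]; omega) []
  rw [← init_mem_eq_initFun hwid] at hrel
  -- setup
  obtain ⟨S₁, hex₁, h1, h2, h3, h4, h20⟩ := setup1_spec (O := O) W hF []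
  rw [merge_self] at hex₁
  have hex₂ := pow_spec (O := O) c (relocated (inp W)) h2 h4 hpow hF []
  obtain ⟨S₃, H₁, hex₃, hRg₃, h30₃, hQhd, hH₁⟩ := setup2_spec (O := O) W (c := c)
    (S := Function.update S₁ 4 (n ^ c))
    (by rw [Function.update_of_ne (by norm_num), h1]) (by rw [Function.update_of_ne (by norm_num), h2])
    (by rw [Function.update_of_ne (by norm_num), h3]) (by rw [Function.update_self])
    (by rw [Function.update_of_ne (by norm_num), h20]) hF hQw []
  -- the setup data
  have hH₁code : ∀ t', t' < n * n → H₁ (pC n + t') = code W t' := fun t' ht' => by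
    rw [hH₁ _ (by omega), relocated_code W ht']
  have hH₁cell : ∀ a, IsCell n a → H₁ a = 0 := fun a ha => by
    unfold IsCell at ha; rw [hH₁ _ (by omega), relocated_high W (by omega)]
  -- loop A
  obtain ⟨S₄, hex₄, hRg₄⟩ := loopA_spec (O := O) W hRg₃ h30₃ hH₁code hcode hQ2 hF hQw []
  rw [heapA_zero W (wQ n c) H₁ hH₁cell, heapA_final W (wQ n c) H₁] at hex₄
  -- loop B
  obtain ⟨S₅, hex₅, hRg₅, h30₅⟩ := preB_spec (O := O) (heapB W (wQ n c) H₁ 0) hRg₄ hF []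
  obtain ⟨S₆, hex₆, hRg₆⟩ := loopB_spec (O := O) W (H₁ := H₁) hRg₅ h30₅ hQ2 hF hQw []
  -- the query block
  have hQ₀ : heapB W (wQ n c) H₁ n (pQ n) = 4 * n + 1 := by
    rw [heapB_of_not W (wQ n c) H₁ n (fun h => by unfold IsCell at h; omega), hQhd]
  have hseg : readSeg (heapB W (wQ n c) H₁ n) (pQ n) ((4 * n + 1) * (4 * n + 1) + 1) = qseg W (wQ n c) :=
    readSeg_query W hQ₀ fun U V hU hV => heapB_final W (wQ n c) H₁ hU hV
  -- the query
  have hexQ := Exec.query_dir (w := w) (O := O) (qa := 10) (ql := 15) (aa := 16) (by omega)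
    (by omega) (by omega) (S := S₆) (by rw [hRg₆.r10]; omega) (by rw [hRg₆.r16]; omega)
    (heapB W (wQ n c) H₁ n) []
  rw [hRg₆.r10, hRg₆.r15, hRg₆.r16, hseg, ha] at hexQ
  simp only [List.map_cons, List.map_nil, Nat.mod_eq_of_lt haw, List.nil_append] at hexQ
  -- the finish
  have hcell : segWrite (heapB W (wQ n c) H₁ n) (pR n) [a] (pR n + 1) = a := by
    unfold segWrite
    rw [if_neg (by omega), if_pos ⟨by omega, by simp⟩]
    simp
  obtain ⟨S₇, hex₇, h0₇, h1₇⟩ := finish_spec (O := O) (segWrite (heapB W (wQ n c) H₁ n) (pR n) [a]) hRg₆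
    hcell hF [qseg W (wQ n c)]
  -- assemble the execution
  have hexAll := hrel.execLE.seqs_cons (hex₁.execLE.seqs_cons (hex₂.execLE.seqs_cons
    (hex₃.execLE.seqs_cons (hex₄.seqs_cons (hex₅.execLE.seqs_cons (hex₆.seqs_cons
    (hexQ.execLE.seqs_cons (ExecLE.seqs_one hex₇.execLE))))))))
  refine ⟨_, hexAll.mono ?_, rfl, ?_, ?_⟩
  · rw [inp_length]; omega
  · show merge S₇ (segWrite (heapB W (wQ n c) H₁ n) (pR n) [a]) 0 = 1
    rw [merge_apply_of_lt (by norm_num), h0₇]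
  · show merge S₇ (segWrite (heapB W (wQ n c) H₁ n) (pR n) [a]) 1 = _
    rw [merge_apply_of_lt (by norm_num), h1₇, ha]
    simp

end semantics

end Literature.Computability.FineGrained.NegTriToRadius
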